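import Literature.NumberTheory.EllipticCurves.IsogenyNotRationalCMProofs
import Literature.NumberTheory.EllipticCurves.IsogenyFrobeniusTraceProofs
import Literature.NumberTheory.EllipticCurves.OrdinaryPrimesProofs
import Literature.NumberTheory.EllipticCurves.IsogenyDualProofs
import Literature.NumberTheory.EllipticCurves.QuadraticTwistJInvariantProofs
import Literature.NumberTheory.EllipticCurves.ComplexMultiplicationDeuringReductionProofs
import Literature.NumberTheory.EllipticCurves.ComplexMultiplicationTwistIsogenyCertProofs
import Literature.NumberTheory.EllipticCurves.ComplexMultiplicationDeuring0Proofs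
import Literature.NumberTheory.EllipticCurves.ComplexMultiplicationDeuring1728Proofs
import Literature.NumberTheory.EllipticCurves.LFunctionCoefficientBound
import Mathlib.LinearAlgebra.Matrix.Notation
import Mathlib.NumberTheory.Padics.RingHoms
import Mathlib.Data.Nat.Squarefree
import Mathlib.FieldTheory.Finite.Basic
import HarnessLib

/-!
# Deuring's `a_p = π + π̄` for CM curves over `ℚ` (Cox, *Primes of the form x² + ny²*, Thm. 14.16): discharge

Sibling *proofs* file (D-0014 append protocol: no definitions, every declaration is a theorem) of
`Literature.NumberTheory.EllipticCurves.ComplexMultiplicationCoatesWiles`. It **discharges the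
named fact `Literature.NumberTheory.EllipticCurves.Deuring1941_frobeniusTrace_eq_add_conj`**
(Deuring 1941; in the form printed by Cox, *Primes of the form x² + ny²*, 2nd ed., Thm. 14.16,
PDF pp. 322–323: for `E/ℚ` given by a globally minimal `W` with `j(W) ∈ maximalCMJInvariants`,
i.e. `End_{ℚ̄}(E) ≅ 𝓞_K`, `K = ℚ(√d)`, `d = cmDiscr (j W)` of class number one, and an odd prime
`p ∤ Δ_W` which splits in `K` (`p ∤ d`, `d` a square mod `p`), there is `π ∈ 𝓞_K = ℤ[ω_d]` with
`ππ̄ = p` and `a_p(E) = π + π̄`) as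

* `Literature.NumberTheory.EllipticCurves.Deuring1941_frobeniusTrace_eq_add_conj_holds`.

## The printed proof and the proof given here

Cox (proof of Thm. 14.16, PDF p. 323) argues with Deuring's reduction isomorphism
`End_ℂ(E) ⥲ End_{𝔽̄_p}(Ē)` ("well beyond the scope of this book", Lang, *Elliptic Functions*,
Ch. 13 Thm. 12): the Frobenius of `Ē` lifts to `π ∈ 𝓞_K` of norm `deg Frob_p = p`, and
`#Ē(𝔽_p) = deg(1 - Frob_p) = N(1 - π)`. The tree reduces the fact along these lines to four deep
named facts (`ComplexMultiplicationDeuringReductionProofs`: `End_{ℚ̄}(E) ≅ 𝓞_K`, reduction of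
endomorphisms, Deuring's ordinarity criterion, Lang's Thm. 13.5), none of which is proved. The
cases `j = 0, 1728` are proved in the tree by Gauss–Jacobi sums
(`ComplexMultiplicationDeuring0Proofs`, `ComplexMultiplicationDeuring1728Proofs`).

This file proves the remaining seven cases — and hence the fact — **without reduction of
endomorphisms and without any CM theory**, from results that are all theorems of the tree: the
`ℓ`-adic representation `T_ℓ E ≅ ℤ_ℓ²` with `Γ_ℚ`-action (`TateModule`, `IsogenyNotRationalCMProofs`),
the reduction isomorphism `T_ℓ(E) ≅ T_ℓ(Ẽ)` intertwining an arithmetic Frobenius `σ_p` with the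
Frobenius endomorphism, whence `tr(σ_p | T_ℓ E) = a_p`, `det = p` (Silverman, *AEC*, C.21
Remark 21.3 with Prop. VII.4.1 and Thm. V.2.3.1; the tree's
`trace_galoisRepTate_frobenius_eq_frobeniusTrace`,
`det_galoisRepTate_frobenius_of_hasGoodReductionAt_of_exists_weilPairing`), `End_ℚ(E) = ℤ`
(`not_hasRationalCM_holds`, Silverman, *Advanced Topics*, Thm. II.2.2), `#E[m] = m²`
(`card_torsionPoints_eq_sq_holds`), the kernel-certified cyclic `ℚ`-isogenies `E → E^{(d_K)}` of
degree `7, 11, 19, 43, 67, 163` (`CMIsogenyCertificates`, `IsogenyFormulaDegree`) and Silverman's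
`2`-isogeny for `j = 8000` (`IsogenyTwoTorsionProofs`), and Hasse's bound (`HasseElementary`).
The argument, for `E/ℚ` with `j(E) = j(𝓞_K)`, `j ≠ 0, 1728`, and a `ℚ`-isogeny `λ : E → E'` of
degree `N` onto the twist `E' = E^{(D)}` (`D = d_K`, `N = |d_K|` prime; `D = -2`, `N = 2` for
`d_K = -8`):

1. **The twist endomorphism** (`DeuringLadic.exists_twist_end`). With the twisting isomorphism
   `τ : E ≅ E'`, `(x, y) ↦ (Dx, D√D y)`, defined over `ℚ(√D)`, `μ = τ⁻¹ ∘ λ` is an algebraic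
   additive endomorphism of `E(ℚ̄)` which commutes with the `g ∈ Γ_ℚ` fixing `√D` and
   *anti-commutes* with those negating it (a coordinate computation,
   `DeuringLadic.iso_smul`, `iso_smul_neg`). Hence `μ ∘ μ ∈ End_ℚ(E) = ℤ`, say `μ² = [m]`
   (`exists_mul_self_eq_intCast`), and `|m| = #ker λ = N` by counting `ker(μ²) = E[m]` through
   the surjection `μ : E[m] → ker μ` (`natAbs_eq_of_mul_self_eq_intCast`). The same holds on any
   `W` with `j(W) = j(E)`, by transport along a `ℚ̄`-isomorphism `W ≅ E` commuting with `Γ_ℚ` up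
   to sign (`exists_iso_of_j_eq`, `exists_transport_end`; Silverman, *AEC*, X.5.4).
2. **The `ℓ`-adic core** (`DeuringLadic.exists_mul_frobeniusTrace_sq_sub_eq_sq`). For a prime
   `ℓ ≠ p`, in a basis of `T_ℓ W`: `F = ρ_ℓ(σ_p)` has `tr F = a_p`, `det F = p`, and `a_p² ≠ 4p`, so
   `F` is not scalar; `σ_p` fixes `√D` because `p` splits (`smul_eq_self_of_isArithFrobAt`:
   `σ√D ≡ √D^p = √D · D^{(p-1)/2} ≡ √D (mod 𝔓)` by Euler's criterion), so `M = T_ℓ μ` commutes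
   with `F` and `M = u + vF`; a complex conjugation negates `√D` (`exists_smul_eq_neg_of_sq_eq`),
   so `M` is conjugate to `-M` and `tr M = 0`; with `M² = m` this gives `4m = v²(a_p² - 4p)`,
   `v ≠ 0` (`Matrix.exists_four_mul_eq_of_commute`). Thus `m(a_p² - 4p)` is a square in `ℚ_ℓ`
   for every `ℓ ≠ p`, hence a square in `ℤ` by the **weak global square theorem**
   (`isSquare_of_forall_isSquare_padic`: a non-square `B = ε t² c` is a non-residue at some odd
   prime outside any finite set — Chinese remainder theorem, quadratic reciprocity for Jacobi
   symbols and `jacobiSym.eq_neg_one_at_prime_divisor_of_eq_neg_one`; no Dirichlet theorem).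
3. **The sign and `π`** (`exists_pi_of_isogeny_prime`, `exists_pi_of_j_eq_8000`). Hasse's bound
   `a_p² ≤ 4p` (`frobeniusTrace_sq_le`) makes `a_p² - 4p < 0`, so `m < 0`, `m = -N = d_K`
   (resp. `m = -2`), and `a_p² - 4p = d_K w²`; then `π = (a_p + w√d_K)/2 = (a_p - d_K w)/2 + w ω`
   lies in `ℤ[ω_{d_K}]`, `ππ̄ = p`, `π + π̄ = a_p` (`exists_pi_of_sq_sub_eq`; Cox (7.1), Lemma 7.2).

| source item | Lean declaration | status |
|---|---|---|
| Cox Thm. 14.16 (`a_p = π + π̄`, `p = ππ̄`), nine `j` | `Deuring1941_frobeniusTrace_eq_add_conj_holds` | **proved** |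
| `ℓ`-adic core (Silverman C.21 Rem. 21.3, III.§7) | `DeuringLadic.exists_mul_frobeniusTrace_sq_sub_eq_sq` | proved |
| weak global square theorem | `DeuringLadic.isSquare_of_forall_isSquare_padic` | proved |
| twist endomorphism `τ⁻¹ ∘ λ`, `μ² = [m]`, `|m| = deg λ` | `DeuringLadic.exists_twist_end`, `exists_mul_self_eq_intCast`, `natAbs_eq_of_mul_self_eq_intCast` | proved |
| engine for `j ≠ 0, 1728` | `DeuringLadic.exists_natAbs_eq_and_mul_eq_sq` | proved |
| the seven cases `d_K = -7, -8, -11, -19, -43, -67, -163` | `DeuringLadic.exists_pi_of_j_eq_…` | proved |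

## References

* [Cox2013] D. A. Cox, *Primes of the form x² + ny²*, 2nd ed., Wiley (2013): §14.C, Thm. 14.16
  and its proof (PDF pp. 322–323; read: `lit read book:cox2013-primes-form-i-x-sup-2-sup`),
  (14.13), §14.B; (7.1), Lemma 7.2; Prop. 5.16 (splitting of `p` in `K`).
* [Deuring1941] M. Deuring, *Die Typen der Multiplikatorenringe elliptischer Funktionenkörper*,
  Abh. Math. Sem. Univ. Hamburg 14 (1941), 197–272.
* [SilvermanAEC2009] J. H. Silverman, *The Arithmetic of Elliptic Curves*, 2nd ed., GTM 106
  (2009): III.§7 (`T_ℓ`, Prop. III.7.1), III.1 Table 3.1, III.4 Example 4.5, Thm. III.4.8,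
  Thm. III.4.10, Cor. III.6.4(b), Thm. V.1.1, Thm. V.2.3.1, Prop. VII.4.1, X.2, X.5 Prop. 5.4 and
  Cor. 5.4.1, C.21 Remark 21.3.
* [SilvermanAdvancedTopics1994] J. H. Silverman, *Advanced Topics in the Arithmetic of Elliptic
  Curves*, GTM 151 (1994): Thm. II.2.2(a) and Remark II.2.2.2 (`End_ℚ(E) = ℤ`), App. A §3 (the
  CM curves over `ℚ`).
* [Lang1987] S. Lang, *Elliptic Functions*, 2nd ed., GTM 112 (1987), Ch. 13 §4 Thm. 12 (the
  lifting theorem used in print and avoided here).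

## Design

`noncomputable section`, `open scoped Classical`; the auxiliary theorems live in the namespace
`Literature.NumberTheory.EllipticCurves.DeuringLadic`, the discharge in
`Literature.NumberTheory.EllipticCurves`. No definitions are introduced: the matrix representation
of `T_ℓ`, the twist endomorphism and the transported endomorphism are produced existentially. The
Galois computations on `ℚ̄`-points are done with `Aut(ℚ̄/ℚ)` acting on `(W.baseChange ℚ̄).Point`
(Mathlib's `Affine.Point.map`), to which the action of `Γ_ℚ` on `W.geomPoints` is definitionally
equal. Mathlib/tree search: `lean search` for `frobeniusTrace_eq_add_conj`, `isSquare_of_forall`,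
`exists_tateMatrixRep`, `twist_end` found only the tree declarations cited above; Mathlib has no
isogenies, Tate modules of elliptic curves or CM theory.
-/

noncomputable section

open scoped Classical NumberField ComplexConjugate
open IsDedekindDomain Field WeierstrassCurve Literature.NumberTheory.EllipticCurves
  Literature.NumberTheory.GaloisRepresentations

universe u

namespace Literature.NumberTheory.EllipticCurves.DeuringLadic

/-! ### Local squares are squares modulo `ℓ` -/

/-- If an integer `B` is a square in `ℚ_ℓ`, then it is a square modulo `ℓ` (a square root has
norm `≤ 1`, so lies in `ℤ_ℓ`, and reduces modulo `ℓ`). [folklore] -/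
theorem isSquare_zmod_of_isSquare_padic {ℓ : ℕ} [Fact ℓ.Prime] {B : ℤ}
    (h : IsSquare ((B : ℚ_[ℓ]))) : IsSquare ((B : ZMod ℓ)) := by
  obtain ⟨y, hy⟩ := h
  have hy1 : ‖y‖ ≤ 1 := by
    by_contra hlt
    push Not at hlt
    have h1 : (1 : ℝ) < ‖y‖ * ‖y‖ := by nlinarith [norm_nonneg y]
    have h2 : ‖y‖ * ‖y‖ ≤ 1 := by
      rw [← norm_mul, ← hy]
      exact Padic.norm_int_le_one B
    linarith
  set z : ℤ_[ℓ] := ⟨y, hy1⟩ with hz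
  have hBz : ((B : ℤ_[ℓ]) : ℚ_[ℓ]) = ((z * z : ℤ_[ℓ]) : ℚ_[ℓ]) := by
    rw [PadicInt.coe_mul, PadicInt.coe_intCast]
    exact hy
  have hBz' : (B : ℤ_[ℓ]) = z * z := PadicInt.ext hBz
  refine ⟨PadicInt.toZMod z, ?_⟩
  rw [← map_mul, ← hBz', map_intCast]

/-- If `B = B₀ t²` with `t ≠ 0` is a square in a field, so is `B₀`. [folklore] -/
theorem isSquare_of_isSquare_mul_sq {F : Type*} [Field F] {B₀ t : F} (ht : t ≠ 0)
    (h : IsSquare (B₀ * t ^ 2)) : IsSquare B₀ := by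
  obtain ⟨y, hy⟩ := h
  refine ⟨y / t, ?_⟩
  field_simp
  linear_combination hy

/-! ### Jacobi symbols prescribed by congruences -/

/-- `J(-1 | N) = -1` for `N ≡ 3 (mod 4)`. [folklore] -/
theorem jacobiSym_neg_one_of_mod_four {N : ℕ} (hN : N % 4 = 3) : jacobiSym (-1) N = -1 := by
  rw [jacobiSym.at_neg_one (Nat.odd_iff.mpr (by omega)), ZMod.χ₄_nat_three_mod_four hN]

/-- `J(±2 | N) = -1` for `N ≡ 5 (mod 8)`. [folklore] -/
theorem jacobiSym_two_of_mod_eight {ε : ℤ} (hε : ε = 1 ∨ ε = -1) {N : ℕ} (hN : N % 8 = 5) :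
    jacobiSym (ε * 2) N = -1 := by
  have hodd : Odd N := Nat.odd_iff.mpr (by omega)
  have hN2 : N % 2 = 1 := by omega
  have h2 : jacobiSym 2 N = -1 := by
    rw [jacobiSym.at_two hodd, ZMod.χ₈_nat_eq_if_mod_eight]
    simp [hN, hN2]
  rcases hε with rfl | rfl
  · rw [one_mul, h2]
  · rw [jacobiSym.mul_left, jacobiSym.at_neg_one hodd, ZMod.χ₄_nat_one_mod_four (by omega), h2]
    norm_num

/-- For `c'` odd, `q₁ ∣ c'` and `N ≡ 1 (mod 8)` with `J(N | q₁) = -1` and `N ≡ 1 (mod c'/q₁)`: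
`J(ε 2ᵉ c' | N) = -1` (`ε = ±1`, `e ∈ {0, 1}`), by quadratic reciprocity. [folklore] -/
theorem jacobiSym_eq_neg_one_of_congr {ε : ℤ} (hε : ε = 1 ∨ ε = -1) {e : ℕ} (he : e = 0 ∨ e = 1)
    {c' q₁ : ℕ} (hc' : Odd c') (hq₁ : q₁ ∣ c') {N : ℕ} (hN8 : N % 8 = 1)
    (hNq : jacobiSym N q₁ = -1) (hNc : N % (c' / q₁) = 1 % (c' / q₁)) :
    jacobiSym (ε * 2 ^ e * c') N = -1 := by
  have hodd : Odd N := Nat.odd_iff.mpr (by omega)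
  have hN4 : N % 4 = 1 := by omega
  have hq0 : q₁ ≠ 0 := by
    rintro rfl
    rw [zero_dvd_iff] at hq₁
    subst hq₁
    exact (Nat.not_even_iff_odd.mpr hc') (by decide)
  obtain ⟨c'', hc''⟩ := hq₁
  have hc''0 : c'' ≠ 0 := by
    rintro rfl
    rw [mul_zero] at hc''
    subst hc''
    exact (Nat.not_even_iff_odd.mpr hc') (by decide)
  have hdiv : c' / q₁ = c'' := by
    rw [hc'', Nat.mul_div_cancel_left _ (Nat.pos_of_ne_zero hq0)]
  rw [hdiv] at hNc
  have hεN : jacobiSym ε N = 1 := by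
    rcases hε with rfl | rfl
    · exact jacobiSym.one_left N
    · rw [jacobiSym.at_neg_one hodd, ZMod.χ₄_nat_one_mod_four hN4]
  have h2N : jacobiSym (2 ^ e) N = 1 := by
    rcases he with rfl | rfl
    · rw [pow_zero]; exact jacobiSym.one_left N
    · have hN2 : N % 2 = 1 := by omega
      rw [pow_one, jacobiSym.at_two hodd, ZMod.χ₈_nat_eq_if_mod_eight]
      simp [hN8, hN2]
  have hc'N : jacobiSym (c' : ℤ) N = -1 := by
    rw [jacobiSym.quadratic_reciprocity_one_mod_four' hc' hN4, hc'', jacobiSym.mul_right' _ hq0 hc''0,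
      hNq]
    have : jacobiSym (N : ℤ) c'' = 1 := by
      rw [jacobiSym.mod_left, show ((N : ℤ) % c'') = ((N % c'' : ℕ) : ℤ) by push_cast; rfl, hNc,
        show (((1 % c'' : ℕ)) : ℤ) = (1 : ℤ) % c'' by push_cast; rfl, ← jacobiSym.mod_left,
        jacobiSym.one_left]
    rw [this, mul_one]
  rw [jacobiSym.mul_left, jacobiSym.mul_left, hεN, h2N, hc'N]
  norm_num

end Literature.NumberTheory.EllipticCurves.DeuringLadic

namespace Literature.NumberTheory.EllipticCurves.DeuringLadic

/-- A residue class forcing `J(ε c | N) = -1`: for `ε = ±1` and `c` squarefree with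
`(ε, c) ≠ (1, 1)` there are an even modulus `M₀`, all of whose odd prime factors divide `c`, and
an odd residue `r₀` such that `J(ε c | N) = -1` for every `N ≡ r₀ (mod M₀)`. [folklore] -/
theorem exists_modulus_jacobiSym_eq_neg_one {ε : ℤ} (hε : ε = 1 ∨ ε = -1) {c : ℕ}
    (hc : Squarefree c) (h1 : ¬ (ε = 1 ∧ c = 1)) :
    ∃ M₀ r₀ : ℕ, 0 < M₀ ∧ 2 ∣ M₀ ∧ ¬ 2 ∣ r₀ ∧ (∀ ℓ : ℕ, ℓ.Prime → ℓ ∣ M₀ → ℓ = 2 ∨ ℓ ∣ c) ∧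
      ∀ N : ℕ, N ≡ r₀ [MOD M₀] → jacobiSym (ε * c) N = -1 := by
  have hc0 : c ≠ 0 := Squarefree.ne_zero hc
  by_cases hc1 : c = 1
  · -- `c = 1`, `ε = -1`: `N ≡ 3 (mod 4)`
    subst hc1
    have hε' : ε = -1 := by
      rcases hε with rfl | rfl
      · exact absurd ⟨rfl, rfl⟩ h1
      · rfl
    subst hε'
    refine ⟨4, 3, by norm_num, by norm_num, by norm_num, fun ℓ hℓ hℓ4 => Or.inl ?_, fun N hN => ?_⟩
    · have : ℓ ∣ 2 ^ 2 := by simpa using hℓ4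
      exact (Nat.prime_dvd_prime_iff_eq hℓ Nat.prime_two).mp (hℓ.dvd_of_dvd_pow this)
    · rw [Nat.cast_one, mul_one]
      exact jacobiSym_neg_one_of_mod_four hN
  by_cases hc2 : c = 2
  · -- `c = 2`: `N ≡ 5 (mod 8)`
    subst hc2
    refine ⟨8, 5, by norm_num, by norm_num, by norm_num, fun ℓ hℓ hℓ8 => Or.inl ?_, fun N hN => ?_⟩
    · have : ℓ ∣ 2 ^ 3 := by simpa using hℓ8
      exact (Nat.prime_dvd_prime_iff_eq hℓ Nat.prime_two).mp (hℓ.dvd_of_dvd_pow this)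
    · exact jacobiSym_two_of_mod_eight hε hN
  -- general case: the odd part `c'` of `c` exceeds `1`
  obtain ⟨e, c', h2c', hcc'⟩ := Nat.exists_eq_pow_mul_and_not_dvd hc0 2 (by norm_num)
  have hc'odd : Odd c' := Nat.odd_iff.mpr (Nat.two_dvd_ne_zero.mp h2c')
  have he : e = 0 ∨ e = 1 := by
    rcases Nat.lt_or_ge e 2 with h | h
    · omega
    · exfalso
      have h22 : 2 * 2 ∣ 2 ^ e := by rw [← pow_two]; exact pow_dvd_pow 2 h
      have h4 : 2 * 2 ∣ c := by
        rw [hcc']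
        exact Dvd.dvd.mul_right h22 _
      have := hc 2 h4
      norm_num at this
  have hc'1 : c' ≠ 1 := by
    rintro rfl
    rcases he with rfl | rfl
    · exact hc1 (by rw [hcc']; norm_num)
    · exact hc2 (by rw [hcc']; norm_num)
  have hc'0 : c' ≠ 0 := by
    rintro rfl
    exact hc0 (by rw [hcc', mul_zero])
  have hsqc' : Squarefree c' := by
    rw [hcc'] at hc
    exact Squarefree.of_mul_right hc
  -- an odd prime `q₁ ∣ c'` and a non-residue `z` modulo `q₁`
  set q₁ := c'.minFac with hq₁
  have hq₁p : q₁.Prime := Nat.minFac_prime hc'1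
  have hq₁c' : q₁ ∣ c' := Nat.minFac_dvd c'
  have hq₁2 : q₁ ≠ 2 := by
    rintro h
    rw [h] at hq₁c'
    exact h2c' hq₁c'
  haveI : Fact q₁.Prime := ⟨hq₁p⟩
  obtain ⟨a, ha⟩ := FiniteField.exists_nonsquare (F := ZMod q₁) (by rwa [ZMod.ringChar_zmod_n])
  set z : ℕ := a.val with hz
  have hzq : jacobiSym (z : ℤ) q₁ = -1 := by
    rw [ZMod.nonsquare_iff_jacobiSym_eq_neg_one, hz, Int.cast_natCast, ZMod.natCast_zmod_val]
    exact ha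
  obtain ⟨c'', hc''⟩ := hq₁c'
  have hc''0 : c'' ≠ 0 := by
    rintro rfl
    exact hc'0 (by rw [hc'', mul_zero])
  have hcop1 : Nat.Coprime q₁ c'' := by
    rw [hc''] at hsqc'
    exact (Nat.squarefree_mul_iff.mp hsqc').1
  have hc''odd : ¬ 2 ∣ c'' := fun h => h2c' (hc'' ▸ Dvd.dvd.mul_left h q₁)
  have hcop8 : Nat.Coprime 8 q₁ := by
    have : Nat.Coprime 2 q₁ := (Nat.coprime_primes Nat.prime_two hq₁p).mpr (Ne.symm hq₁2)
    simpa using this.pow_left 3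
  have hcop8' : Nat.Coprime (8 * q₁) c'' := by
    refine Nat.Coprime.mul_left ?_ hcop1
    have : Nat.Coprime 2 c'' := (Nat.Prime.coprime_iff_not_dvd Nat.prime_two).mpr hc''odd
    simpa using this.pow_left 3
  -- the residue `r₀ mod 8 q₁ c''`
  obtain ⟨r₁, hr₁8, hr₁q⟩ := Nat.chineseRemainder hcop8 1 z
  obtain ⟨r₀, hr₀, hr₀c⟩ := Nat.chineseRemainder hcop8' r₁ 1
  refine ⟨8 * q₁ * c'', r₀, Nat.mul_pos (Nat.mul_pos (by norm_num) hq₁p.pos) (Nat.pos_of_ne_zero hc''0),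
    ⟨4 * q₁ * c'', by ring⟩, ?_, fun ℓ hℓ hℓM => ?_,
    fun N hN => ?_⟩
  · -- `r₀` is odd
    intro h2
    have h8 : r₀ ≡ r₁ [MOD 8] := hr₀.of_mul_right q₁
    have : r₀ % 8 = 1 := by
      have := h8.trans hr₁8
      exact this
    omega
  · -- prime factors of the modulus
    rcases (Nat.Prime.dvd_mul hℓ).mp hℓM with h | h
    · rcases (Nat.Prime.dvd_mul hℓ).mp h with h' | h'
      · left
        have : ℓ ∣ 2 ^ 3 := by simpa using h'
        exact (Nat.prime_dvd_prime_iff_eq hℓ Nat.prime_two).mp (hℓ.dvd_of_dvd_pow this)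
      · right
        rw [hcc', hc'']
        exact Dvd.dvd.mul_left (Dvd.dvd.mul_right h' _) _
    · right
      rw [hcc', hc'']
      exact Dvd.dvd.mul_left (Dvd.dvd.mul_left h _) _
  · -- the symbol
    have hN8 : N % 8 = 1 := ((hN.of_mul_right c'').of_mul_right q₁).trans (hr₀.of_mul_right q₁ |>.trans hr₁8)
    have hNq : N ≡ z [MOD q₁] :=
      ((hN.of_mul_right c'').of_mul_left 8).trans ((hr₀.of_mul_left 8).trans hr₁q)
    have hNc : N % c'' = 1 % c'' := (hN.of_mul_left (8 * q₁)).trans hr₀c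
    have hNq' : jacobiSym (N : ℤ) q₁ = -1 := by
      rw [jacobiSym.mod_left, show ((N : ℤ) % q₁) = ((N % q₁ : ℕ) : ℤ) by push_cast; rfl,
        show N % q₁ = z % q₁ from hNq, show ((z % q₁ : ℕ) : ℤ) = (z : ℤ) % q₁ by push_cast; rfl,
        ← jacobiSym.mod_left, hzq]
    have hdiv : c' / q₁ = c'' := by
      rw [hc'', Nat.mul_div_cancel_left _ hq₁p.pos]
    rw [hcc', Nat.cast_mul, Nat.cast_pow, Nat.cast_ofNat, ← mul_assoc]
    exact jacobiSym_eq_neg_one_of_congr hε he hc'odd ⟨c'', hc''⟩ hN8 hNq' (by rw [hdiv]; exact hNc)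

/-- **Odd primes outside any finite set at which a non-square class is a non-residue.** For
`ε = ±1`, `c` squarefree, `(ε, c) ≠ (1, 1)` and a finite set `S` of naturals there is an odd
prime `ℓ ∉ S` with `J(ε c | ℓ) = -1` (Chinese remainder theorem and
`jacobiSym.eq_neg_one_at_prime_divisor_of_eq_neg_one`; no Dirichlet theorem is needed). [folklore] -/
theorem exists_prime_not_mem_jacobiSym_eq_neg_one {ε : ℤ} (hε : ε = 1 ∨ ε = -1) {c : ℕ}
    (hc : Squarefree c) (h1 : ¬ (ε = 1 ∧ c = 1)) (S : Finset ℕ) :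
    ∃ ℓ : ℕ, ℓ.Prime ∧ ℓ ≠ 2 ∧ ℓ ∉ S ∧ jacobiSym (ε * c) ℓ = -1 := by
  obtain ⟨M₀, r₀, hM₀, hM₀2, hr₀, hprime, hJ⟩ := exists_modulus_jacobiSym_eq_neg_one hε hc h1
  -- avoid the primes of `S` coprime to `M₀`
  set M : ℕ := ∏ q ∈ S.filter (fun q => Nat.Coprime q M₀), q with hM
  have hcop : Nat.Coprime M₀ M := by
    rw [hM, Nat.coprime_prod_right_iff]
    intro q hq
    exact (Finset.mem_filter.mp hq).2.symm
  obtain ⟨N, hN₀, hN₁⟩ := Nat.chineseRemainder hcop r₀ 1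
  have hJN : jacobiSym (ε * c) N = -1 := hJ N hN₀
  obtain ⟨ℓ, hℓ, hℓN, hℓJ⟩ := jacobiSym.eq_neg_one_at_prime_divisor_of_eq_neg_one hJN
  have hNodd : ¬ 2 ∣ N := by
    intro h2
    obtain ⟨k, hk⟩ := hM₀2
    have h : N ≡ r₀ [MOD 2] := by
      have := hN₀
      rw [hk] at this
      exact this.of_mul_right k
    change N % 2 = r₀ % 2 at h
    apply hr₀
    omega
  refine ⟨ℓ, hℓ, ?_, fun hℓS => ?_, hℓJ⟩
  · rintro rfl
    exact hNodd hℓN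
  · by_cases hℓc : Nat.Coprime ℓ M₀
    · -- `ℓ ∣ M`, so `N ≡ 1 (mod ℓ)`, but `ℓ ∣ N`
      have hℓM : ℓ ∣ M := by
        rw [hM]
        exact Finset.dvd_prod_of_mem _ (Finset.mem_filter.mpr ⟨hℓS, hℓc⟩)
      have h1ℓ : N ≡ 1 [MOD ℓ] := hN₁.of_dvd hℓM
      have hN0 : N % ℓ = 0 := Nat.mod_eq_zero_of_dvd hℓN
      have h10 : 1 % ℓ = 0 := by
        change N % ℓ = 1 % ℓ at h1ℓ
        rw [← h1ℓ, hN0]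
      have : ℓ ∣ 1 := Nat.dvd_of_mod_eq_zero h10
      exact hℓ.one_lt.ne' (Nat.dvd_one.mp this)
    · -- `ℓ ∣ M₀`, so `ℓ ∣ c` (as `ℓ ≠ 2`), and the symbol vanishes
      have hℓM₀ : ℓ ∣ M₀ := by
        rwa [Nat.Prime.coprime_iff_not_dvd hℓ, not_not] at hℓc
      rcases hprime ℓ hℓ hℓM₀ with rfl | hℓc'
      · exact hNodd hℓN
      · have hdvd : (ℓ : ℤ) ∣ ε * c := Dvd.dvd.mul_left (Int.natCast_dvd_natCast.mpr hℓc') ε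
        have : jacobiSym (ε * c) ℓ = 0 := by
          rw [jacobiSym.mod_left, Int.emod_eq_zero_of_dvd hdvd, jacobiSym.zero_left hℓ.one_lt]
        rw [this] at hℓJ
        norm_num at hℓJ

end Literature.NumberTheory.EllipticCurves.DeuringLadic

namespace Literature.NumberTheory.EllipticCurves.DeuringLadic

/-- **Weak global square theorem.** A non-zero integer which is a square in `ℚ_ℓ` for every
prime `ℓ` outside a finite set is a perfect square: writing `B = ε t² c` with `ε = ±1` and `c`
squarefree, if `(ε, c) ≠ (1, 1)` there is an odd prime `ℓ ∉ S`, `ℓ ∤ c`, with `(ε c / ℓ) = -1`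
(`exists_prime_not_mem_jacobiSym_eq_neg_one`), at which `ε c = B / t²` is not even a square
modulo `ℓ`. (The full statement — a non-square is a non-square in infinitely many completions —
is classical, e.g. a consequence of Chebotarev or of Dirichlet's theorem; this elementary form
suffices here.) [folklore] -/
theorem isSquare_of_forall_isSquare_padic {B : ℤ} (hB : B ≠ 0) (S : Finset ℕ)
    (h : ∀ (ℓ : ℕ) [Fact ℓ.Prime], ℓ ∉ S → IsSquare ((B : ℚ_[ℓ]))) : IsSquare B := by
  by_contra hns
  obtain ⟨c, t, htc, hc⟩ := Nat.sq_mul_squarefree B.natAbs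
  set ε : ℤ := B.sign with hε
  have hεB : ε * (t : ℤ) ^ 2 * c = B := by
    rw [mul_assoc, ← Int.sign_mul_natAbs B, ← htc]
    push_cast
    ring
  have hε1 : ε = 1 ∨ ε = -1 := by
    rcases lt_trichotomy B 0 with hlt | rfl | hgt
    · exact Or.inr (Int.sign_eq_neg_one_of_neg hlt)
    · exact absurd rfl hB
    · exact Or.inl (Int.sign_eq_one_of_pos hgt)
  have ht0 : t ≠ 0 := by
    rintro rfl
    apply hB
    rw [← hεB]
    simp
  have h11 : ¬ (ε = 1 ∧ c = 1) := by
    rintro ⟨h1, h2⟩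
    apply hns
    refine ⟨t, ?_⟩
    rw [← hεB, h1, h2]
    push_cast
    ring
  obtain ⟨ℓ, hℓ, hℓ2, hℓS, hJ⟩ := exists_prime_not_mem_jacobiSym_eq_neg_one hε1 hc h11 S
  haveI : Fact ℓ.Prime := ⟨hℓ⟩
  have hsq : IsSquare (((ε * c : ℤ)) : ℚ_[ℓ]) := by
    have hB' := h ℓ hℓS
    rw [← hεB] at hB'
    push_cast at hB' ⊢
    refine isSquare_of_isSquare_mul_sq (t := (t : ℚ_[ℓ])) (by exact_mod_cast ht0) ?_
    have hrw : (ε : ℚ_[ℓ]) * (c : ℚ_[ℓ]) * (t : ℚ_[ℓ]) ^ 2 = (ε : ℚ_[ℓ]) * (t : ℚ_[ℓ]) ^ 2 * (c : ℚ_[ℓ]) := by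
      ring
    rw [hrw]
    exact hB'
  have hsq' := isSquare_zmod_of_isSquare_padic hsq
  exact (ZMod.nonsquare_iff_jacobiSym_eq_neg_one.mp hJ) hsq'

end Literature.NumberTheory.EllipticCurves.DeuringLadic

namespace Literature.NumberTheory.EllipticCurves.DeuringLadic

/-- **Cayley–Hamilton for `2 × 2` matrices**: `A² = tr(A) A - det(A)`. [folklore] -/
theorem Matrix.sq_eq_trace_smul_sub_det_fin_two {R : Type*} [CommRing R]
    (A : Matrix (Fin 2) (Fin 2) R) : A * A = A.trace • A - A.det • (1 : Matrix (Fin 2) (Fin 2) R) := by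
  obtain ⟨e, f, g, h, rfl⟩ : ∃ e f g h : R, A = !![e, f; g, h] :=
    ⟨A 0 0, A 0 1, A 1 0, A 1 1, Matrix.eta_fin_two A⟩
  rw [Matrix.trace_fin_two_of, Matrix.det_fin_two_of, Matrix.mul_fin_two, Matrix.smul_of,
    Matrix.one_fin_two, Matrix.smul_of]
  ext i j
  fin_cases i <;> fin_cases j <;> simp <;> ring

/-- **The centraliser of a non-scalar `2 × 2` matrix over a field is `F[A]`**: if
`tr(A)² ≠ 4 det(A)` (so that `A` is not a scalar matrix) and `M` commutes with `A`, then
`M = u + v A` for some `u, v ∈ F`. [folklore] -/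
theorem Matrix.exists_eq_smul_one_add_smul_of_commute {F : Type*} [Field F]
    {A M : Matrix (Fin 2) (Fin 2) F} (hA : A.trace ^ 2 - 4 * A.det ≠ 0) (hAM : M * A = A * M) :
    ∃ u v : F, M = u • (1 : Matrix (Fin 2) (Fin 2) F) + v • A := by
  obtain ⟨p, q, r, s, rfl⟩ : ∃ p q r s : F, A = !![p, q; r, s] :=
    ⟨A 0 0, A 0 1, A 1 0, A 1 1, Matrix.eta_fin_two A⟩
  obtain ⟨e, f, g, h, rfl⟩ : ∃ e f g h : F, M = !![e, f; g, h] :=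
    ⟨M 0 0, M 0 1, M 1 0, M 1 1, Matrix.eta_fin_two M⟩
  rw [Matrix.trace_fin_two_of, Matrix.det_fin_two_of] at hA
  rw [Matrix.mul_fin_two, Matrix.mul_fin_two] at hAM
  have a11 := congrFun (congrFun hAM 0) 0
  have a12 := congrFun (congrFun hAM 0) 1
  have a21 := congrFun (congrFun hAM 1) 0
  simp only [Matrix.of_apply, Matrix.cons_val', Matrix.cons_val_zero, Matrix.cons_val_one,
    Matrix.cons_val_fin_one, Matrix.empty_val'] at a11 a12 a21
  -- `f r = q g`, `q (e - h) = f (p - s)`, `g (p - s) = r (e - h)`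
  have E1 : f * r = q * g := by linear_combination a11
  have E2 : q * (e - h) = f * (p - s) := by linear_combination a12
  have E3 : g * (p - s) = r * (e - h) := by linear_combination a21
  have key : ∀ u v : F, e = u + v * p → f = v * q → g = v * r → h = u + v * s →
      !![e, f; g, h] = u • (1 : Matrix (Fin 2) (Fin 2) F) + v • !![p, q; r, s] := by
    intro u v he hf hg hh
    rw [Matrix.one_fin_two, Matrix.smul_of, Matrix.smul_of]
    ext i j
    fin_cases i <;> fin_cases j <;> simp [he, hf, hg, hh]
  by_cases hq : q = 0
  · by_cases hr : r = 0
    · -- `A` diagonal with `p ≠ s`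
      subst hq hr
      have hps : p - s ≠ 0 := by
        intro h0
        apply hA
        have : p = s := by linear_combination h0
        subst this
        ring
      have hf : f = 0 := by
        have : f * (p - s) = 0 := by linear_combination -E2
        exact (mul_eq_zero.mp this).resolve_right hps
      have hg : g = 0 := by
        have : g * (p - s) = 0 := by linear_combination E3
        exact (mul_eq_zero.mp this).resolve_right hps
      refine ⟨e - (e - h) / (p - s) * p, (e - h) / (p - s), key _ _ (by ring) (by simp [hf])
        (by simp [hg]) ?_⟩
      field_simp
      ring
    · -- `r ≠ 0`
      refine ⟨e - g / r * p, g / r, key _ _ (by ring) ?_ ?_ ?_⟩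
      · field_simp
        linear_combination E1
      · field_simp
      · field_simp
        linear_combination E3
  · -- `q ≠ 0`
    refine ⟨e - f / q * p, f / q, key _ _ (by ring) ?_ ?_ ?_⟩
    · field_simp
    · field_simp
      linear_combination -E1
    · field_simp
      linear_combination -E2

/-- The trace of `u + v A` is `2u + v tr(A)`. [folklore] -/
theorem Matrix.trace_smul_one_add_smul_fin_two {R : Type*} [CommRing R] (A : Matrix (Fin 2) (Fin 2) R)
    (u v : R) : (u • (1 : Matrix (Fin 2) (Fin 2) R) + v • A).trace = 2 * u + v * A.trace := by
  rw [Matrix.trace_add, Matrix.trace_smul, Matrix.trace_smul, Matrix.trace_one, Fintype.card_fin,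
    smul_eq_mul, smul_eq_mul]
  push_cast
  ring

/-- **The key computation.** Over a field of characteristic `0`: if `F` has trace `a` and
determinant `p` with `a² ≠ 4p` (so `F` is not scalar), and `M` commutes with `F`, has trace `0`
and satisfies `M² = m`, then `M = -(a v / 2) + v F` for some `v` with `4 m = v² (a² - 4 p)`
(so `m (a² - 4p) = (v (a² - 4p) / 2)²` is a square, non-zero as soon as `m ≠ 0`). [folklore] -/
theorem Matrix.exists_four_mul_eq_of_commute {K : Type*} [Field K] [CharZero K]
    {F M : Matrix (Fin 2) (Fin 2) K} {a p m : K} (htr : F.trace = a) (hdet : F.det = p)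
    (ha : a ^ 2 - 4 * p ≠ 0) (hFM : M * F = F * M) (hM0 : M.trace = 0)
    (hMM : M * M = m • (1 : Matrix (Fin 2) (Fin 2) K)) :
    ∃ v : K, M = (-(a * v / 2)) • (1 : Matrix (Fin 2) (Fin 2) K) + v • F ∧
      4 * m = v ^ 2 * (a ^ 2 - 4 * p) := by
  have hA : F.trace ^ 2 - 4 * F.det ≠ 0 := by rwa [htr, hdet]
  obtain ⟨u, v, hM⟩ := Matrix.exists_eq_smul_one_add_smul_of_commute hA hFM
  have hu : u = -(a * v / 2) := by
    have h := hM0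
    rw [hM, Matrix.trace_smul_one_add_smul_fin_two, htr] at h
    linear_combination h / 2
  refine ⟨v, by rw [hM, hu], ?_⟩
  -- `M² = (u² - p v²) + v (2u + a v) F = u² - p v²`
  have hCH := Matrix.sq_eq_trace_smul_sub_det_fin_two F
  rw [htr, hdet] at hCH
  have hsq : M * M = (u ^ 2 - p * v ^ 2) • (1 : Matrix (Fin 2) (Fin 2) K) +
      (v * (2 * u + a * v)) • F := by
    rw [hM, add_mul, mul_add, mul_add, smul_mul_smul_comm, smul_mul_smul_comm, smul_mul_smul_comm,
      smul_mul_smul_comm, one_mul, one_mul, mul_one, hCH, smul_sub, smul_smul, smul_smul]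
    ext i j
    simp only [Matrix.add_apply, Matrix.smul_apply, Matrix.sub_apply, smul_eq_mul]
    ring
  have h2u : 2 * u + a * v = 0 := by rw [hu]; ring
  rw [h2u, mul_zero, zero_smul, add_zero, hMM] at hsq
  have hm : m = u ^ 2 - p * v ^ 2 := by
    have := congrFun (congrFun hsq 0) 0
    simpa using this
  rw [hm, hu]
  ring

end Literature.NumberTheory.EllipticCurves.DeuringLadic

namespace Literature.NumberTheory.EllipticCurves.DeuringLadic

/-! ### Matrices of `T_ℓ` (variant of `exists_tateMatrixRep` with pointwise commutation) -/

/-- **`End(E(K̄)) → M₂(ℤ_ℓ)` and `Γ_K → M₂(ℤ_ℓ)`.** For an elliptic curve `E / K` and a prime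
`ℓ ≠ char K`, a `ℤ_ℓ`-basis of `T_ℓ E ≅ ℤ_ℓ²` (the tree's `module_free_tateModule_holds`,
`finrank_tateModule_eq_two_holds`; Silverman, *AEC*, Prop. III.7.1) turns `f ↦ T_ℓ f` into a ring
map `R` on the additive endomorphisms of `E(K̄)` and `σ ↦ ρ_ℓ(σ)` into a monoid map `S` on `Γ_K`,
with the same trace and determinant as on `T_ℓ E`, and such that an additive map commuting (resp.
anti-commuting) with the action of one `σ ∈ Γ_K` on `E(K̄)` has matrix commuting (resp.
anti-commuting) with `S σ` (*AEC* III.§7). Variant of the tree's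
`WeierstrassCurve.exists_tateMatrixRep`. [cite: SilvermanAEC2009, III.§7 and Prop. III.7.1] -/
theorem exists_tateMatrixRep' {K : Type u} [Field K] (W : WeierstrassCurve K) [W.IsElliptic]
    (ℓ : ℕ) [Fact ℓ.Prime] (hℓ : (ℓ : K) ≠ 0) :
    ∃ (R : AddMonoid.End W.geomPoints →+* Matrix (Fin 2) (Fin 2) ℤ_[ℓ])
      (S : absoluteGaloisGroup K →* Matrix (Fin 2) (Fin 2) ℤ_[ℓ]),
      (∀ σ, (S σ).trace =
        LinearMap.trace ℤ_[ℓ] _ (W.galoisRepTate ℓ σ : W.tateModule ℓ →ₗ[ℤ_[ℓ]] W.tateModule ℓ)) ∧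
      (∀ σ, (S σ).det =
        LinearMap.det (W.galoisRepTate ℓ σ : W.tateModule ℓ →ₗ[ℤ_[ℓ]] W.tateModule ℓ)) ∧
      (∀ (f : AddMonoid.End W.geomPoints) (σ : absoluteGaloisGroup K),
        (∀ P, f (σ • P) = σ • f P) → R f * S σ = S σ * R f) ∧
      (∀ (f : AddMonoid.End W.geomPoints) (σ : absoluteGaloisGroup K),
        (∀ P, f (σ • P) = -(σ • f P)) → R f * S σ = -(S σ * R f)) := by
  haveI := WeierstrassCurve.module_free_tateModule_holds W ℓ
  haveI := WeierstrassCurve.module_finite_tateModule_holds W ℓ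
  let b := Module.finBasisOfFinrankEq ℤ_[ℓ] (W.tateModule ℓ)
    (WeierstrassCurve.finrank_tateModule_eq_two_holds W ℓ hℓ)
  let e : Module.End ℤ_[ℓ] (W.tateModule ℓ) ≃ₐ[ℤ_[ℓ]] Matrix (Fin 2) (Fin 2) ℤ_[ℓ] :=
    LinearMap.toMatrixAlgEquiv b
  let ρT : AddMonoid.End W.geomPoints →+* Module.End ℤ_[ℓ] (W.tateModule ℓ) :=
    { toFun := fun f ↦ TateModule.map ℓ f
      map_one' := TateModule.map_id
      map_mul' := fun _ _ ↦ TateModule.map_comp _ _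
      map_zero' := LinearMap.ext fun _ ↦ TateModule.ext fun _ ↦ rfl
      map_add' := fun _ _ ↦ LinearMap.ext fun _ ↦ TateModule.ext fun _ ↦ rfl }
  refine ⟨e.toRingEquiv.toRingHom.comp ρT,
    e.toRingEquiv.toRingHom.toMonoidHom.comp (W.galoisRepTate ℓ), fun σ ↦ ?_, fun σ ↦ ?_,
    fun f σ hf ↦ ?_, fun f σ hf ↦ ?_⟩
  · change (LinearMap.toMatrix b b (W.galoisRepTate ℓ σ)).trace = _
    rw [← LinearMap.trace_eq_matrix_trace]
  · change (LinearMap.toMatrix b b (W.galoisRepTate ℓ σ)).det = _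
    rw [LinearMap.det_toMatrix]
  · change e (TateModule.map ℓ f) * e (W.galoisRepTate ℓ σ) =
      e (W.galoisRepTate ℓ σ) * e (TateModule.map ℓ f)
    rw [← map_mul, ← map_mul]
    congr 1
    exact LinearMap.ext fun x ↦ TateModule.ext fun n ↦ hf _
  · change e (TateModule.map ℓ f) * e (W.galoisRepTate ℓ σ) =
      -(e (W.galoisRepTate ℓ σ) * e (TateModule.map ℓ f))
    rw [← map_mul, ← map_mul, ← map_neg]
    congr 1
    refine LinearMap.ext fun x ↦ TateModule.ext fun n ↦ ?_
    rw [LinearMap.neg_apply, map_neg]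
    exact hf _

/-! ### Galois-theoretic inputs: Frobenius fixes `√d` at split `p`, complex conjugation negates it -/

/-- A natural number lies in the finite place `v` of `ℚ` iff the prime under `v` divides it.
[folklore] -/
theorem natCast_mem_asIdeal_iff (v : HeightOneSpectrum (𝓞 ℚ)) (n : ℕ) :
    (n : 𝓞 ℚ) ∈ v.asIdeal ↔ (Rat.HeightOneSpectrum.primesEquiv v : ℕ) ∣ n := by
  change _ ↔ Rat.HeightOneSpectrum.natGenerator v ∣ n
  rw [Rat.HeightOneSpectrum.natGenerator_dvd_iff, Ideal.mem_map_of_equiv]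
  constructor
  · intro h
    exact ⟨n, h, map_natCast _ n⟩
  · rintro ⟨x, hx, hxn⟩
    have : x = n := (Rat.IsIntegralClosure.intEquiv (𝓞 ℚ)).injective (by rw [hxn, map_natCast])
    rwa [this] at hx

/-- An integer lies in the finite place `v` of `ℚ` iff the prime under `v` divides it. [folklore] -/
theorem intCast_mem_asIdeal_iff (v : HeightOneSpectrum (𝓞 ℚ)) (n : ℤ) :
    (n : 𝓞 ℚ) ∈ v.asIdeal ↔ ((Rat.HeightOneSpectrum.primesEquiv v : ℕ) : ℤ) ∣ n := by
  change _ ↔ ((Rat.HeightOneSpectrum.natGenerator v : ℕ) : ℤ) ∣ n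
  rw [← Ideal.mem_span_singleton, Rat.HeightOneSpectrum.span_natGenerator, Ideal.mem_map_of_equiv]
  constructor
  · intro h
    exact ⟨n, h, map_intCast _ n⟩
  · rintro ⟨x, hx, hxn⟩
    have : x = n := (Rat.IsIntegralClosure.intEquiv (𝓞 ℚ)).injective (by rw [hxn, map_intCast, Int.cast_id])
    rwa [this] at hx

/-- **An arithmetic Frobenius at a prime over a split `p` fixes `√d`.** Let `p` be an odd prime,
`d` an integer with `p ∤ d` and `d` a square modulo `p`, `s ∈ ℚ̄` with `s² = d`, `v` the place
of `ℚ` at `p`, `𝔓 ∣ v` a prime of `\bar ℤ` and `σ` an arithmetic Frobenius at `𝔓`. Then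
`σ s = s`: `σ s ≡ s^p = s · d^{(p-1)/2} ≡ s (mod 𝔓)` by Euler's criterion, `σ s = ± s`, and
`σ s = -s` would give `2 s ∈ 𝔓`, `4d ∈ 𝔓 ∩ ℤ = pℤ`. (The decomposition group of `𝔓` fixes the
completion `ℚ_p ⊇ ℚ(√d)`.) [folklore] -/
theorem smul_eq_self_of_isArithFrobAt {p : ℕ} (hp : p.Prime) (h2 : p ≠ 2) {d : ℤ}
    (hpd : ¬ (p : ℤ) ∣ d) (hsq : IsSquare ((d : ℤ) : ZMod p)) {s : AlgebraicClosure ℚ}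
    (hs : s ^ 2 = (d : AlgebraicClosure ℚ)) {v : HeightOneSpectrum (𝓞 ℚ)}
    (hv : (Rat.HeightOneSpectrum.primesEquiv v : ℕ) = p) {𝔓 : Ideal (absIntegers (𝓞 ℚ) ℚ)}
    (h𝔓 : 𝔓 ∈ v.primesAbove) {σ : absoluteGaloisGroup ℚ} (hσ : IsArithFrobAt (𝓞 ℚ) σ 𝔓) :
    σ • s = s := by
  haveI : 𝔓.IsPrime := h𝔓.1
  haveI : Fact p.Prime := ⟨hp⟩
  -- `s` as an algebraic integer
  have hsi : IsIntegral (𝓞 ℚ) s := by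
    refine IsIntegral.of_pow two_pos ?_
    rw [hs, show (d : AlgebraicClosure ℚ) = algebraMap (𝓞 ℚ) (AlgebraicClosure ℚ) (d : 𝓞 ℚ) by
      rw [map_intCast]]
    exact isIntegral_algebraMap
  set x : absIntegers (𝓞 ℚ) ℚ := ⟨s, hsi⟩ with hx
  have hxs : (x : AlgebraicClosure ℚ) = s := rfl
  have hx2 : x ^ 2 = (d : absIntegers (𝓞 ℚ) ℚ) := Subtype.ext (by simp [hxs, hs])
  -- `p ∈ 𝔓`
  have hpv : (p : 𝓞 ℚ) ∈ v.asIdeal := (natCast_mem_asIdeal_iff v p).mpr (by rw [hv])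
  have hp𝔓 : (p : absIntegers (𝓞 ℚ) ℚ) ∈ 𝔓 := by
    have := hpv
    rw [h𝔓.2.over, Ideal.mem_under, map_natCast] at this
    exact this
  -- Euler's criterion: `p ∣ d ^ (p / 2) - 1`
  have hres : v.residueCard = p := by
    rw [← WeierstrassCurve.natCard_residueField_eq_residueCard v,
      WeierstrassCurve.natCard_residueField_adicCompletionIntegers v, hv]
  have hd0 : ((d : ℤ) : ZMod p) ≠ 0 := by
    rwa [Ne, ZMod.intCast_zmod_eq_zero_iff_dvd]
  have heuler : (p : ℤ) ∣ d ^ (p / 2) - 1 := by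
    rw [← ZMod.intCast_zmod_eq_zero_iff_dvd]
    push_cast
    rw [(ZMod.euler_criterion p hd0).mp hsq, sub_self]
  have hdk : ((d : absIntegers (𝓞 ℚ) ℚ)) ^ (p / 2) - 1 ∈ 𝔓 := by
    obtain ⟨k, hk⟩ := heuler
    have : ((d : absIntegers (𝓞 ℚ) ℚ)) ^ (p / 2) - 1 = (p : absIntegers (𝓞 ℚ) ℚ) * (k : absIntegers (𝓞 ℚ) ℚ) := by
      have h := congrArg (fun z : ℤ => (z : absIntegers (𝓞 ℚ) ℚ)) hk
      push_cast at h
      exact h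
    rw [this]
    exact 𝔓.mul_mem_right _ hp𝔓
  -- `x ^ p - x ∈ 𝔓`
  have hodd : p = 2 * (p / 2) + 1 := by
    have := hp.eq_two_or_odd'.resolve_left h2
    obtain ⟨k, hk⟩ := this
    omega
  have hxp : x ^ p - x ∈ 𝔓 := by
    have : x ^ p - x = x * (((d : absIntegers (𝓞 ℚ) ℚ)) ^ (p / 2) - 1) := by
      conv_lhs => rw [hodd]
      rw [pow_succ, pow_mul, hx2]
      ring
    rw [this]
    exact 𝔓.mul_mem_left _ hdk
  -- hence `σ • x - x ∈ 𝔓`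
  have hσx : σ • x - x ∈ 𝔓 := by
    have h := (HeightOneSpectrum.isArithFrobAt_iff_of_mem_primesAbove h𝔓 σ).mp hσ x
    rw [hres] at h
    have : σ • x - x = (σ • x - x ^ p) + (x ^ p - x) := by ring
    rw [this]
    exact 𝔓.add_mem h hxp
  -- `σ • x = ± x`
  have hσd : σ • (d : absIntegers (𝓞 ℚ) ℚ) = d := by
    rw [← MulSemiringAction.toRingHom_apply, map_intCast]
  have hσx2 : (σ • x) ^ 2 = (d : absIntegers (𝓞 ℚ) ℚ) := by
    rw [← smul_pow', hx2, hσd]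
  have hprod : (σ • x - x) * (σ • x + x) = 0 := by
    have : (σ • x - x) * (σ • x + x) = (σ • x) ^ 2 - x ^ 2 := by ring
    rw [this, hσx2, hx2, sub_self]
  rcases mul_eq_zero.mp hprod with h0 | h0
  · -- `σ • x = x`
    have h1 : σ • x = x := sub_eq_zero.mp h0
    have h' := congrArg (fun z : absIntegers (𝓞 ℚ) ℚ => (z : AlgebraicClosure ℚ)) h1
    simpa [hxs, integralClosure.coe_smul] using h'
  · -- `σ • x = -x`: then `2x ∈ 𝔓`, `4d ∈ 𝔓 ∩ ℤ = pℤ`, impossible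
    exfalso
    have hneg : σ • x = -x := eq_neg_of_add_eq_zero_left h0
    have h2x : (2 : absIntegers (𝓞 ℚ) ℚ) * x ∈ 𝔓 := by
      have : σ • x - x = -((2 : absIntegers (𝓞 ℚ) ℚ) * x) := by rw [hneg]; ring
      rw [this] at hσx
      exact (neg_mem_iff (x := (2 : absIntegers (𝓞 ℚ) ℚ) * x)).mp hσx
    have h4d : ((4 * d : ℤ) : absIntegers (𝓞 ℚ) ℚ) ∈ 𝔓 := by
      have : ((4 * d : ℤ) : absIntegers (𝓞 ℚ) ℚ) = (2 * x) * (2 * x) := by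
        push_cast
        rw [← hx2]
        ring
      rw [this]
      exact 𝔓.mul_mem_left _ h2x
    have h4d' : ((4 * d : ℤ) : 𝓞 ℚ) ∈ v.asIdeal := by
      rw [h𝔓.2.over, Ideal.mem_under, map_intCast]
      exact h4d
    rw [intCast_mem_asIdeal_iff, hv] at h4d'
    have hp' : Prime (p : ℤ) := Nat.prime_iff_prime_int.mp hp
    rcases hp'.dvd_or_dvd h4d' with h4 | hd
    · have : (p : ℤ) ∣ 2 ^ 2 := by norm_num; exact h4
      have h2' := hp'.dvd_of_dvd_pow this
      have : p ∣ 2 := by exact_mod_cast h2'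
      exact h2 ((Nat.prime_dvd_prime_iff_eq hp Nat.prime_two).mp this)
    · exact hpd hd


/-- **Complex conjugation negates `√d` for `d < 0`.** There is `c ∈ Γ_ℚ` with `c • s = -s`
whenever `s² = d < 0`: under an embedding `ι : ℚ̄ → ℂ` compatible with a complex conjugation `c`
(the tree's `exists_isComplexConjugation`), `ι s` is purely imaginary. [folklore] -/
theorem exists_smul_eq_neg_of_sq_eq {d : ℤ} (hd : d < 0) {s : AlgebraicClosure ℚ}
    (hs : s ^ 2 = (d : AlgebraicClosure ℚ)) : ∃ c : absoluteGaloisGroup ℚ, c • s = -s := by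
  obtain ⟨c, hc⟩ := exists_isComplexConjugation (Rat.castHom ℝ)
  obtain ⟨ι, -, hι⟩ := isComplexConjugation_iff.mp hc
  refine ⟨c, ι.injective ?_⟩
  rw [hι, map_neg]
  set z : ℂ := ι s with hz
  have hz2 : z ^ 2 = (d : ℂ) := by rw [hz, ← map_pow, hs, map_intCast]
  have hre : (z ^ 2).re = z.re ^ 2 - z.im ^ 2 := by simp [pow_two, Complex.mul_re]
  have him : (z ^ 2).im = 2 * z.re * z.im := by simp [pow_two, Complex.mul_im]; ring
  rw [hz2] at hre him
  simp only [Complex.intCast_re, Complex.intCast_im] at hre him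
  have hzre : z.re = 0 := by
    by_contra h0
    have hzim : z.im = 0 := by
      have : 2 * z.re * z.im = 0 := him.symm
      rcases mul_eq_zero.mp this with h | h
      · exact absurd ((mul_eq_zero.mp h).resolve_left two_ne_zero) h0
      · exact h
    rw [hzim] at hre
    have : (d : ℝ) < 0 := by exact_mod_cast hd
    nlinarith [sq_nonneg z.re]
  apply Complex.ext
  · simp [hzre]
  · simp


/-- `a² ≠ 4p` for a prime `p` and an integer `a`. [folklore] -/
theorem sq_sub_four_mul_prime_ne_zero (a : ℤ) {p : ℕ} (hp : p.Prime) : a ^ 2 - 4 * p ≠ 0 := by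
  intro h
  have hp' : Prime (p : ℤ) := Nat.prime_iff_prime_int.mp hp
  have hdvd : (p : ℤ) ∣ a ^ 2 := ⟨4, by linear_combination h⟩
  obtain ⟨k, rfl⟩ := hp'.dvd_of_dvd_pow hdvd
  have h2 := hp.two_le
  have hp0 : (p : ℤ) ≠ 0 := by exact_mod_cast hp.ne_zero
  have hk : (p : ℤ) * k ^ 2 = 4 := by
    have : (p : ℤ) * ((p : ℤ) * k ^ 2 - 4) = 0 := by linear_combination h
    have := (mul_eq_zero.mp this).resolve_left hp0
    linear_combination this
  have hk1 : k ≤ 1 := by nlinarith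
  have hk2 : -1 ≤ k := by nlinarith
  interval_cases k
  · have : (p : ℤ) = 4 := by linarith
    have : p = 4 := by exact_mod_cast this
    subst this
    norm_num at hp
  · simp at hk
  · have : (p : ℤ) = 4 := by linarith
    have : p = 4 := by exact_mod_cast this
    subst this
    norm_num at hp

/-! ### The core `ℓ`-adic theorem -/

/-- **The `ℓ`-adic core of the proof of `a_p = π + π̄`.** Let `W/ℚ` be a globally minimal
elliptic curve, `p ∤ Δ_W` an odd prime, `d < 0` an integer with `p ∤ d` and `d` a square modulo
`p`, `s = √d ∈ ℚ̄`, and `μ` an additive endomorphism of `E(ℚ̄)` with `μ ∘ μ = [m]` (`m ≠ 0`) which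
commutes with every `g ∈ Γ_ℚ` fixing `s` and anti-commutes with every `g` negating `s` (in the
application: `μ = τ⁻¹ ∘ λ` for a `ℚ`-isogeny `λ : E → E^{(d)}` and the twisting isomorphism `τ`
over `ℚ(√d)`, an endomorphism of `E` defined over `ℚ(√d)`). Then `m (a_p² - 4p)` is a non-zero
square. Proof: for every prime `ℓ ≠ p`, on `T_ℓ E ≅ ℤ_ℓ²` an arithmetic Frobenius `σ_p` (which
fixes `s`, `smul_eq_self_of_isArithFrobAt`) acts with trace `a_p` and determinant `p` (the tree's
`trace_galoisRepTate_frobenius_eq_frobeniusTrace`, Silverman C.21 Remark 21.3, and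
`det_galoisRepTate_frobenius_of_hasGoodReductionAt_of_exists_weilPairing`), `T_ℓ μ` commutes with
it and has trace `0` (it is conjugate to `-T_ℓ μ` by a complex conjugation), so
`T_ℓ μ = -(a v/2) + v σ_p` and `4m = v² (a_p² - 4p)` with `v ∈ ℚ_ℓ^×`
(`Matrix.exists_four_mul_eq_of_commute`); hence `m (a_p² - 4p)` is a square in every `ℚ_ℓ`,
`ℓ ≠ p`, and the weak global square theorem (`isSquare_of_forall_isSquare_padic`) applies.
[cite: SilvermanAEC2009, C.21 Remark 21.3 and III.§7] -/
theorem exists_mul_frobeniusTrace_sq_sub_eq_sq (W : WeierstrassCurve ℚ) [W.IsElliptic]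
    [W.IsGloballyMinimal] {p : ℕ} (hp : p.Prime) (h2 : p ≠ 2)
    (hΔ : ¬ (p : ℤ) ∣ WeierstrassCurve.minimalDiscriminantInt W) {d : ℤ} (hd : d < 0)
    (hpd : ¬ (p : ℤ) ∣ d) (hsq : IsSquare ((d : ℤ) : ZMod p)) {s : AlgebraicClosure ℚ}
    (hs : s ^ 2 = (d : AlgebraicClosure ℚ)) (μ : AddMonoid.End W.geomPoints) {m : ℤ}
    (hm : m ≠ 0) (hμμ : ∀ P, μ (μ P) = m • P)
    (hμ₁ : ∀ g : absoluteGaloisGroup ℚ, g • s = s → ∀ P, μ (g • P) = g • μ P)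
    (hμ₂ : ∀ g : absoluteGaloisGroup ℚ, g • s = -s → ∀ P, μ (g • P) = -(g • μ P)) :
    ∃ r : ℤ, r ≠ 0 ∧ m * (W.frobeniusTrace p ^ 2 - 4 * p) = r ^ 2 := by
  haveI : Fact p.Prime := ⟨hp⟩
  -- the place `v` at `p`
  obtain ⟨v, rfl⟩ : ∃ v : HeightOneSpectrum (𝓞 ℚ), (Rat.HeightOneSpectrum.primesEquiv v : ℕ) = p :=
    ⟨Rat.HeightOneSpectrum.primesEquiv.symm ⟨p, hp⟩, by rw [Equiv.apply_symm_apply]⟩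
  set a : ℤ := W.frobeniusTrace (Rat.HeightOneSpectrum.primesEquiv v) with ha
  have ha4 : a ^ 2 - 4 * (Rat.HeightOneSpectrum.primesEquiv v : ℕ) ≠ 0 :=
    sq_sub_four_mul_prime_ne_zero a hp
  have hgood : W.HasGoodReductionAt v :=
    (WeierstrassCurve.hasGoodReductionAtPrime_iff_hasGoodReductionAt_ringOfIntegers v W).mp
      (WeierstrassCurve.hasGoodReductionAtPrime_of_not_dvd W _ hΔ)
  obtain ⟨𝔓, h𝔓⟩ := HeightOneSpectrum.primesAbove_nonempty v
  obtain ⟨σ, hσ⟩ := HeightOneSpectrum.exists_isArithFrobAt_of_mem_primesAbove_holds h𝔓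
  have hσs : σ • s = s := smul_eq_self_of_isArithFrobAt hp h2 hpd hsq hs rfl h𝔓 hσ
  obtain ⟨c, hc⟩ := exists_smul_eq_neg_of_sq_eq hd hs
  -- `μ ∘ μ = [m]` in `End(E(ℚ̄))`
  have hμ2 : μ * μ = (m : AddMonoid.End W.geomPoints) :=
    AddMonoidHom.ext fun P => hμμ P
  -- for every prime `ℓ ≠ p`, `m (a² - 4p)` is a square in `ℚ_ℓ`
  have hloc : ∀ (ℓ : ℕ) [Fact ℓ.Prime], ℓ ∉ ({(Rat.HeightOneSpectrum.primesEquiv v : ℕ)} : Finset ℕ) →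
      IsSquare (((m * (a ^ 2 - 4 * (Rat.HeightOneSpectrum.primesEquiv v : ℕ)) : ℤ)) : ℚ_[ℓ]) := by
    intro ℓ _ hℓS
    have hne : (Rat.HeightOneSpectrum.primesEquiv v : ℕ) ≠ ℓ := fun h => hℓS (by simp [h])
    have hℓQ : (ℓ : ℚ) ≠ 0 := Nat.cast_ne_zero.mpr (Fact.out : ℓ.Prime).ne_zero
    have hℓv : (ℓ : 𝓞 ℚ) ∉ v.asIdeal :=
      WeierstrassCurve.natCast_not_mem_asIdeal_of_primesEquiv_ne Fact.out hne
    obtain ⟨R, S, hStr, hSdet, hcomm, hanti⟩ := exists_tateMatrixRep' W ℓ hℓQ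
    -- Frobenius: trace `a`, determinant `p`
    have htr : (S σ).trace = (a : ℤ_[ℓ]) := by
      rw [hStr, W.trace_galoisRepTate_frobenius_eq_frobeniusTrace ℓ hne hgood h𝔓 hσ]
    have hdet : (S σ).det = ((Rat.HeightOneSpectrum.primesEquiv v : ℕ) : ℤ_[ℓ]) := by
      rw [hSdet, WeierstrassCurve.det_galoisRepTate_frobenius_of_hasGoodReductionAt_of_exists_weilPairing
        (fun n => WeierstrassCurve.exists_weilPairing_holds W _) v hℓv hgood h𝔓 hσ,
        WeierstrassCurve.natCard_residueField_adicCompletionIntegers v]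
    -- the matrix of `μ`: commutes with Frobenius, anti-commutes with `c`, squares to `m`
    have hMF : R μ * S σ = S σ * R μ := hcomm μ σ (hμ₁ σ hσs)
    have hMc : R μ * S c = -(S c * R μ) := hanti μ c (hμ₂ c hc)
    have hMM : R μ * R μ = (m : Matrix (Fin 2) (Fin 2) ℤ_[ℓ]) := by
      rw [← map_mul, hμ2, map_intCast]
    have hM0 : (R μ).trace = 0 := by
      have hAB : S c * S c⁻¹ = 1 := by rw [← map_mul, mul_inv_cancel, map_one]
      have hBA : S c⁻¹ * S c = 1 := by rw [← map_mul, inv_mul_cancel, map_one]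
      have h : (R μ).trace = -(R μ).trace := by
        calc (R μ).trace = (R μ * (S c * S c⁻¹)).trace := by rw [hAB, mul_one]
          _ = (-(S c * R μ) * S c⁻¹).trace := by rw [← mul_assoc, hMc]
          _ = -((S c * (R μ * S c⁻¹)).trace) := by rw [neg_mul, Matrix.trace_neg, mul_assoc]
          _ = -((R μ * S c⁻¹ * S c).trace) := by rw [Matrix.trace_mul_comm]
          _ = -(R μ).trace := by rw [mul_assoc, hBA, mul_one]
      have h2 : (R μ).trace + (R μ).trace = 0 := by linear_combination h
      exact add_self_eq_zero.mp h2
    -- pass to `ℚ_ℓ`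
    set f : ℤ_[ℓ] →+* ℚ_[ℓ] := PadicInt.Coe.ringHom with hf
    have hfinj : Function.Injective f := fun x y h => PadicInt.ext h
    set F' : Matrix (Fin 2) (Fin 2) ℚ_[ℓ] := f.mapMatrix (S σ) with hF'
    set M' : Matrix (Fin 2) (Fin 2) ℚ_[ℓ] := f.mapMatrix (R μ) with hM'
    have htr' : F'.trace = (a : ℚ_[ℓ]) := by
      rw [hF', RingHom.mapMatrix_apply, ← AddMonoidHom.map_trace, htr]
      simp [hf]
    have hdet' : F'.det = ((Rat.HeightOneSpectrum.primesEquiv v : ℕ) : ℚ_[ℓ]) := by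
      rw [hF', ← RingHom.map_det, hdet, map_natCast]
    have ha' : (a : ℚ_[ℓ]) ^ 2 - 4 * ((Rat.HeightOneSpectrum.primesEquiv v : ℕ) : ℚ_[ℓ]) ≠ 0 := by
      exact_mod_cast ha4
    have hFM' : M' * F' = F' * M' := by rw [hM', hF', ← map_mul, ← map_mul, hMF]
    have hM0' : M'.trace = 0 := by
      rw [hM', RingHom.mapMatrix_apply, ← AddMonoidHom.map_trace, hM0, map_zero]
    have hMM' : M' * M' = (m : ℚ_[ℓ]) • (1 : Matrix (Fin 2) (Fin 2) ℚ_[ℓ]) := by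
      rw [hM', ← map_mul, hMM, map_intCast, Int.cast_smul_eq_zsmul, zsmul_one]
    obtain ⟨w, -, h4⟩ := Matrix.exists_four_mul_eq_of_commute htr' hdet' ha' hFM' hM0' hMM'
    refine ⟨w * ((a : ℚ_[ℓ]) ^ 2 - 4 * ((Rat.HeightOneSpectrum.primesEquiv v : ℕ) : ℚ_[ℓ])) / 2, ?_⟩
    push_cast
    linear_combination ((a : ℚ_[ℓ]) ^ 2 - 4 * ((Rat.HeightOneSpectrum.primesEquiv v : ℕ) : ℚ_[ℓ])) / 4 * h4
  -- the weak global square theorem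
  obtain ⟨r, hr⟩ := isSquare_of_forall_isSquare_padic (mul_ne_zero hm ha4) _ hloc
  refine ⟨r, ?_, by rw [hr]; ring⟩
  rintro rfl
  exact mul_ne_zero hm ha4 (by rw [hr]; ring)

end Literature.NumberTheory.EllipticCurves.DeuringLadic


namespace Literature.NumberTheory.EllipticCurves.DeuringLadic

/-! ### The Galois action on affine points over `ℚ̄` and on substitution isomorphisms -/

section PointLevel

variable {X E : WeierstrassCurve ℚ}

/-- The action of `Aut(ℚ̄/ℚ)` on an affine `ℚ̄`-point is coordinatewise. [folklore] -/
theorem algEquiv_smul_some (V : WeierstrassCurve ℚ) (σ : (AlgebraicClosure ℚ) ≃ₐ[ℚ] (AlgebraicClosure ℚ)) {x y : (AlgebraicClosure ℚ)}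
    (h : (V.baseChange (AlgebraicClosure ℚ)).toAffine.Nonsingular x y) :
    ∃ h', σ • (Affine.Point.some x y h : (V.baseChange (AlgebraicClosure ℚ)).toAffine.Point) =
      Affine.Point.some (σ x) (σ y) h' :=
  ⟨_, rfl⟩

/-- **Galois behaviour of a `ℚ̄`-isomorphism `X ≅ E` (target with `a₁ = a₃ = 0`).** Let
`C = (u, r, s, t)` be a change of variables over `ℚ̄` with `C • X = E` over `ℚ̄`, inducing
`ι : X(ℚ̄) ≃ E(ℚ̄)`, `(x, y) ↦ (u⁻²(x - r), u⁻³(y - s(x - r) - t))`, and `σ ∈ Aut(ℚ̄/ℚ)` fixing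
`r, s, t`. If `σ u = u` then `ι` commutes with `σ`. Silverman, *AEC*, III.1 Table 3.1, X.2
(twists). [folklore] -/
theorem iso_smul (C : VariableChange (AlgebraicClosure ℚ)) (hC : C • X.baseChange (AlgebraicClosure ℚ) = E.baseChange (AlgebraicClosure ℚ))
    {σ : (AlgebraicClosure ℚ) ≃ₐ[ℚ] (AlgebraicClosure ℚ)} (hu : σ ((C.u : (AlgebraicClosure ℚ)ˣ) : (AlgebraicClosure ℚ)) = C.u) (hr : σ C.r = C.r)
    (hs : σ C.s = C.s) (ht : σ C.t = C.t) (P : (X.baseChange (AlgebraicClosure ℚ)).toAffine.Point) :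
    ((VariableChange.pointEquiv (X.baseChange (AlgebraicClosure ℚ)) C).trans (Affine.Point.congrEquiv hC)) (σ • P) =
      σ • ((VariableChange.pointEquiv (X.baseChange (AlgebraicClosure ℚ)) C).trans (Affine.Point.congrEquiv hC)) P := by
  rcases P with _ | ⟨x, y, hxy⟩
  · rw [← Affine.Point.zero_def, smul_zero, map_zero, smul_zero]
  · obtain ⟨h1, e1⟩ := algEquiv_smul_some X σ hxy
    have e3 := pointEquiv_trans_congrEquiv_some C hC h1
    have e4 := pointEquiv_trans_congrEquiv_some C hC hxy
    rw [e1]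
    erw [e3, e4]
    obtain ⟨h2, e2⟩ := algEquiv_smul_some E σ
      (hC ▸ (VariableChange.nonsingular_iff (X.baseChange (AlgebraicClosure ℚ)) C x y).mpr hxy)
    refine Eq.trans ?_ e2.symm
    congr 1 <;>
      simp only [VariableChange.toX_def, VariableChange.toY_def, Units.val_inv_eq_inv_val, map_mul,
        map_sub, map_pow, map_inv₀, hu, hr, hs, ht]

/-- If instead `σ u = -u` (and `E` has `a₁ = a₃ = 0`), then `ι (σ P) = -(σ (ι P))`.
Silverman, *AEC*, III.1 Table 3.1, X.2. [folklore] -/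
theorem iso_smul_neg (C : VariableChange (AlgebraicClosure ℚ)) (hC : C • X.baseChange (AlgebraicClosure ℚ) = E.baseChange (AlgebraicClosure ℚ))
    (ha₁ : E.a₁ = 0) (ha₃ : E.a₃ = 0)
    {σ : (AlgebraicClosure ℚ) ≃ₐ[ℚ] (AlgebraicClosure ℚ)} (hu : σ ((C.u : (AlgebraicClosure ℚ)ˣ) : (AlgebraicClosure ℚ)) = -C.u) (hr : σ C.r = C.r)
    (hs : σ C.s = C.s) (ht : σ C.t = C.t) (P : (X.baseChange (AlgebraicClosure ℚ)).toAffine.Point) :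
    ((VariableChange.pointEquiv (X.baseChange (AlgebraicClosure ℚ)) C).trans (Affine.Point.congrEquiv hC)) (σ • P) =
      -(σ • ((VariableChange.pointEquiv (X.baseChange (AlgebraicClosure ℚ)) C).trans (Affine.Point.congrEquiv hC)) P) := by
  rcases P with _ | ⟨x, y, hxy⟩
  · rw [← Affine.Point.zero_def, smul_zero, map_zero, smul_zero, neg_zero]
  · obtain ⟨h1, e1⟩ := algEquiv_smul_some X σ hxy
    have e3 := pointEquiv_trans_congrEquiv_some C hC h1
    have e4 := pointEquiv_trans_congrEquiv_some C hC hxy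
    rw [e1]
    erw [e3, e4]
    obtain ⟨h2, e2⟩ := algEquiv_smul_some E σ
      (hC ▸ (VariableChange.nonsingular_iff (X.baseChange (AlgebraicClosure ℚ)) C x y).mpr hxy)
    refine Eq.trans ?_ (congrArg Neg.neg e2).symm
    rw [Affine.Point.neg_some]
    congr 1
    · simp only [VariableChange.toX_def, Units.val_inv_eq_inv_val, map_mul, map_sub, map_pow,
        map_inv₀, hu, hr, inv_neg, neg_sq]
    · simp only [Affine.negY, VariableChange.toX_def, VariableChange.toY_def,
        Units.val_inv_eq_inv_val, map_mul, map_sub, map_pow, map_inv₀, hu,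
        hr, hs, ht, inv_neg, baseChange, map_a₁, map_a₃, ha₁, ha₃, map_zero, zero_mul, sub_zero]
      ring

/-- The inverse isomorphism: if `σ u = u` then `ι⁻¹ (σ Q) = σ (ι⁻¹ Q)`. [folklore] -/
theorem iso_symm_smul (C : VariableChange (AlgebraicClosure ℚ)) (hC : C • X.baseChange (AlgebraicClosure ℚ) = E.baseChange (AlgebraicClosure ℚ))
    {σ : (AlgebraicClosure ℚ) ≃ₐ[ℚ] (AlgebraicClosure ℚ)} (hu : σ ((C.u : (AlgebraicClosure ℚ)ˣ) : (AlgebraicClosure ℚ)) = C.u) (hr : σ C.r = C.r)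
    (hs : σ C.s = C.s) (ht : σ C.t = C.t) (Q : (E.baseChange (AlgebraicClosure ℚ)).toAffine.Point) :
    ((VariableChange.pointEquiv (X.baseChange (AlgebraicClosure ℚ)) C).trans (Affine.Point.congrEquiv hC)).symm (σ • Q) =
      σ • ((VariableChange.pointEquiv (X.baseChange (AlgebraicClosure ℚ)) C).trans (Affine.Point.congrEquiv hC)).symm Q := by
  set ι := (VariableChange.pointEquiv (X.baseChange (AlgebraicClosure ℚ)) C).trans (Affine.Point.congrEquiv hC)
  apply ι.injective
  rw [AddEquiv.apply_symm_apply, iso_smul C hC hu hr hs ht, AddEquiv.apply_symm_apply]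

/-- The inverse isomorphism: if `σ u = -u` (`E` with `a₁ = a₃ = 0`), then
`ι⁻¹ (σ Q) = -(σ (ι⁻¹ Q))`. [folklore] -/
theorem iso_symm_smul_neg (C : VariableChange (AlgebraicClosure ℚ)) (hC : C • X.baseChange (AlgebraicClosure ℚ) = E.baseChange (AlgebraicClosure ℚ))
    (ha₁ : E.a₁ = 0) (ha₃ : E.a₃ = 0)
    {σ : (AlgebraicClosure ℚ) ≃ₐ[ℚ] (AlgebraicClosure ℚ)} (hu : σ ((C.u : (AlgebraicClosure ℚ)ˣ) : (AlgebraicClosure ℚ)) = -C.u) (hr : σ C.r = C.r)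
    (hs : σ C.s = C.s) (ht : σ C.t = C.t) (Q : (E.baseChange (AlgebraicClosure ℚ)).toAffine.Point) :
    ((VariableChange.pointEquiv (X.baseChange (AlgebraicClosure ℚ)) C).trans (Affine.Point.congrEquiv hC)).symm (σ • Q) =
      -(σ • ((VariableChange.pointEquiv (X.baseChange (AlgebraicClosure ℚ)) C).trans (Affine.Point.congrEquiv hC)).symm Q) := by
  set ι := (VariableChange.pointEquiv (X.baseChange (AlgebraicClosure ℚ)) C).trans (Affine.Point.congrEquiv hC)
  apply ι.injective
  rw [AddEquiv.apply_symm_apply, map_neg, iso_smul_neg C hC ha₁ ha₃ hu hr hs ht,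
    AddEquiv.apply_symm_apply, neg_neg]

end PointLevel

/-! ### The twist endomorphism `τ⁻¹ ∘ λ` -/

section TwistEnd

/-- `Γ_ℚ` acts on `√q` (`q ∈ ℚ`) by `±1`. [folklore] -/
theorem smul_eq_self_or_eq_neg {s : (AlgebraicClosure ℚ)} {q : ℚ} (hs : s ^ 2 = algebraMap ℚ (AlgebraicClosure ℚ) q)
    (g : absoluteGaloisGroup ℚ) : g • s = s ∨ g • s = -s := by
  have h : (g • s) ^ 2 = s ^ 2 := by rw [← smul_pow', hs, smul_algebraMap]
  have h' : (g • s - s) * (g • s + s) = 0 := by linear_combination h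
  rcases mul_eq_zero.mp h' with h0 | h0
  · exact Or.inl (sub_eq_zero.mp h0)
  · exact Or.inr (add_eq_zero_iff_eq_neg.mp h0)

variable {E E' : WeierstrassCurve ℚ} [E.IsElliptic] [E'.IsElliptic]

/-- **The twist endomorphism.** Let `λ : E → E'` be a `ℚ`-isogeny and `C = (s⁻¹, 0, 0, 0)` a
change of variables over `ℚ̄` with `C • E = E'` (so `E'` is the quadratic twist of `E` by `s²`,
with `a₁ = a₃ = 0`), inducing the twisting isomorphism `τ : E(ℚ̄) ≃ E'(ℚ̄)` defined over `ℚ(s)`.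
Then `μ = τ⁻¹ ∘ λ` is an algebraic, surjective additive endomorphism of `E(ℚ̄)` with
`ker μ = ker λ`, which commutes with every `g ∈ Γ_ℚ` fixing `s` and anti-commutes with every `g`
with `g s = -s`. (For the CM curves and `s = √d_K` this is the endomorphism `√d_K` up to sign.)
Silverman, *AEC*, X.2 (twists) and III.4. [folklore] -/
theorem exists_twist_end (lam : Isogeny E E') (ha₁ : E'.a₁ = 0) (ha₃ : E'.a₃ = 0)
    {s : (AlgebraicClosure ℚ)} (C : VariableChange (AlgebraicClosure ℚ)) (hC : C • E.baseChange (AlgebraicClosure ℚ) = E'.baseChange (AlgebraicClosure ℚ))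
    (hCu : ((C.u : (AlgebraicClosure ℚ)ˣ) : (AlgebraicClosure ℚ)) = s⁻¹) (hCr : C.r = 0) (hCs : C.s = 0) (hCt : C.t = 0) :
    ∃ μ : AddMonoid.End E.geomPoints,
      IsAlgebraicOn E E μ ∧ Function.Surjective μ ∧
      (∀ P, μ P = 0 ↔ lam P = 0) ∧
      (∀ g : absoluteGaloisGroup ℚ, g • s = s → ∀ P, μ (g • P) = g • μ P) ∧
      (∀ g : absoluteGaloisGroup ℚ, g • s = -s → ∀ P, μ (g • P) = -(g • μ P)) := by
  set ι : E.geomPoints ≃+ E'.geomPoints :=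
    (VariableChange.pointEquiv (E.baseChange (AlgebraicClosure ℚ)) C).trans (Affine.Point.congrEquiv hC) with hι
  refine ⟨ι.symm.toAddMonoidHom.comp lam.toAddMonoidHom, ?_, ?_, fun P => ?_, fun g hg P => ?_,
    fun g hg P => ?_⟩
  · exact IsAlgebraicOn.comp (W := E) (W' := E') (W'' := E) (f := ι.symm.toAddMonoidHom)
      (g := lam.toAddMonoidHom) (isAlgebraicOn_pointEquiv_trans_congrEquiv_symm C hC) lam.isAlgebraic
  · exact ι.symm.surjective.comp lam.surjective
  · change ι.symm (lam P) = 0 ↔ lam P = 0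
    exact ι.symm.map_eq_zero_iff
  · change ι.symm (lam (g • P)) = g • ι.symm (lam P)
    rw [lam.map_smul]
    have hu : (absoluteGaloisGroup.toAlgEquiv ℚ g) ((C.u : (AlgebraicClosure ℚ)ˣ) : (AlgebraicClosure ℚ)) = C.u := by
      rw [hCu]
      change g • s⁻¹ = s⁻¹
      rw [smul_inv'', hg]
    exact iso_symm_smul C hC hu (by rw [hCr]; exact map_zero _) (by rw [hCs]; exact map_zero _)
      (by rw [hCt]; exact map_zero _) (lam P)
  · change ι.symm (lam (g • P)) = -(g • ι.symm (lam P))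
    rw [lam.map_smul]
    have hu : (absoluteGaloisGroup.toAlgEquiv ℚ g) ((C.u : (AlgebraicClosure ℚ)ˣ) : (AlgebraicClosure ℚ)) = -C.u := by
      rw [hCu]
      change g • s⁻¹ = -s⁻¹
      rw [smul_inv'', hg, inv_neg]
    exact iso_symm_smul_neg C hC ha₁ ha₃ hu (by rw [hCr]; exact map_zero _)
      (by rw [hCs]; exact map_zero _) (by rw [hCt]; exact map_zero _) (lam P)

/-- **`μ² ∈ ℤ`.** An algebraic additive endomorphism `μ` of `E(ℚ̄)` (`E/ℚ` elliptic) which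
commutes with the `g ∈ Γ_ℚ` fixing `s = √q` and anti-commutes with those negating it has
`μ ∘ μ ∈ End_ℚ(E) = ℤ`: `μ ∘ μ` lies in `End_{ℚ̄}(E)` and commutes with all of `Γ_ℚ`, and
`End_ℚ(E) = ℤ` by the tree's `not_hasRationalCM_holds` (Silverman, *Advanced Topics*,
Thm. II.2.2). [cite: SilvermanAdvancedTopics1994, Thm. II.2.2(a) and Remark II.2.2.2] -/
theorem exists_mul_self_eq_intCast (W : WeierstrassCurve ℚ) [W.IsElliptic] {s : (AlgebraicClosure ℚ)} {q : ℚ}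
    (hs : s ^ 2 = algebraMap ℚ (AlgebraicClosure ℚ) q) {μ : AddMonoid.End W.geomPoints} (halg : IsAlgebraicOn W W μ)
    (h₁ : ∀ g : absoluteGaloisGroup ℚ, g • s = s → ∀ P, μ (g • P) = g • μ P)
    (h₂ : ∀ g : absoluteGaloisGroup ℚ, g • s = -s → ∀ P, μ (g • P) = -(g • μ P)) :
    ∃ m : ℤ, μ * μ = m := by
  have hmem : μ * μ ∈ W.endRing := by
    refine ⟨mul_mem (Subring.subset_closure halg) (Subring.subset_closure halg), fun g P => ?_⟩
    change μ (μ (g • P)) = g • μ (μ P)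
    rcases smul_eq_self_or_eq_neg hs g with hg | hg
    · rw [h₁ g hg, h₁ g hg]
    · rw [h₂ g hg, map_neg, h₂ g hg, neg_neg]
  have h := not_hasRationalCM_holds W
  simp only [HasRationalCM, not_exists, not_and, not_forall, not_not] at h
  exact h _ hmem

/-- **`|m| = #ker λ` by counting kernels.** If `μ` is a surjective additive endomorphism of
`E(ℚ̄)` with `#ker μ = N` and `μ ∘ μ = [m]`, `m ≠ 0`, then `|m| = N`: `μ` maps `ker(μ ∘ μ) = E[m]`
onto `ker μ` with kernel `ker μ`, so `m² = #E[m] = N²` (`#E[m] = m²`, Silverman, *AEC*,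
Cor. III.6.4(b), the tree's `card_torsionPoints_eq_sq_holds`). [cite: SilvermanAEC2009, Cor. III.6.4(b)] -/
theorem natAbs_eq_of_mul_self_eq_intCast (W : WeierstrassCurve ℚ) [W.IsElliptic]
    {μ : AddMonoid.End W.geomPoints} (hsurj : Function.Surjective μ) {N : ℕ}
    (hker : Nat.card (μ : W.geomPoints →+ W.geomPoints).ker = N) {m : ℤ} (hμ : μ * μ = m)
    (hm : m ≠ 0) : m.natAbs = N := by
  have hμμ : ∀ P, μ (μ P) = m • P := fun P =>
    (congrArg (fun φ : AddMonoid.End W.geomPoints => φ P) hμ).trans (AddMonoid.End.intCast_apply m P)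
  set K₁ : AddSubgroup W.geomPoints := (μ : W.geomPoints →+ W.geomPoints).ker with hK₁
  set K₂ : AddSubgroup W.geomPoints := (μ * μ : W.geomPoints →+ W.geomPoints).ker with hK₂
  have hmemK₂ : ∀ P, P ∈ K₂ ↔ μ (μ P) = 0 := fun P => Iff.rfl
  have hmemK₁ : ∀ P, P ∈ K₁ ↔ μ P = 0 := fun P => Iff.rfl
  -- `μ` restricted to `K₂` lands in `K₁`
  set f : K₂ →+ K₁ := ((μ : W.geomPoints →+ W.geomPoints).comp K₂.subtype).codRestrict K₁
    (fun P => (hmemK₁ _).mpr ((hmemK₂ P.1).mp P.2)) with hf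
  have hf_apply : ∀ P : K₂, (f P : W.geomPoints) = μ P := fun P => rfl
  have hfsurj : Function.Surjective f := by
    intro Q
    obtain ⟨P, hP⟩ := hsurj Q
    have hP2 : P ∈ K₂ := by
      rw [hmemK₂, hP]
      exact (hmemK₁ _).mp Q.2
    exact ⟨⟨P, hP2⟩, Subtype.ext (by rw [hf_apply]; exact hP)⟩
  -- `ker f ≃ K₁`
  have hkerf : Nat.card f.ker = N := by
    rw [← hker]
    refine Nat.card_congr ?_
    refine
      { toFun := (fun P => ⟨P.1.1, ?_⟩)
        invFun := (fun Q => ⟨⟨Q.1, ?_⟩, ?_⟩)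
        left_inv := ?_
        right_inv := ?_ }
    · have h := P.2
      rw [AddMonoidHom.mem_ker] at h
      have h' := congrArg (fun R : K₁ => (R : W.geomPoints)) h
      rw [hmemK₁]
      simpa [hf_apply] using h'
    · rw [hmemK₂, (hmemK₁ _).mp Q.2, map_zero]
    · rw [AddMonoidHom.mem_ker]
      exact Subtype.ext (by rw [hf_apply]; exact (hmemK₁ _).mp Q.2)
    · intro P; rfl
    · intro Q; rfl
  have hquot : Nat.card (K₂ ⧸ f.ker) = N := by
    rw [← hker]
    exact Nat.card_congr (QuotientAddGroup.quotientKerEquivOfSurjective f hfsurj).toEquiv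
  have hcard₂ : Nat.card K₂ = N * N := by
    rw [AddSubgroup.card_eq_card_quotient_mul_card_addSubgroup f.ker, hquot, hkerf]
  -- `K₂ = E[|m|]` has `m²` elements
  haveI : CharZero (AlgebraicClosure ℚ) :=
    charZero_of_injective_algebraMap (algebraMap ℚ (AlgebraicClosure ℚ)).injective
  have htors : K₂ = geomTorsion W ((m.natAbs : ℕ) : ℤ) := by
    ext P
    rw [hmemK₂, hμμ]
    rw [show (P ∈ geomTorsion W ((m.natAbs : ℕ) : ℤ)) ↔ ((m.natAbs : ℕ) : ℤ) • P = 0 from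
      Submodule.mem_torsionBy_iff _ P]
    rcases Int.natAbs_eq m with h | h
    · rw [← h]
    · conv_lhs => rw [h]
      rw [neg_smul, neg_eq_zero]
  have hcard₂' : Nat.card K₂ = m.natAbs ^ 2 := by
    rw [htors]
    exact card_torsionPoints_eq_sq_holds W (AlgebraicClosure ℚ) (by exact_mod_cast (Int.natAbs_ne_zero.mpr hm))
  rw [hcard₂, pow_two] at hcard₂'
  exact (Nat.mul_self_inj.mp hcard₂').symm

end TwistEnd

/-! ### Transport along `ℚ̄`-isomorphisms with a sign rule -/

section Transport

/-- The inverse of an isomorphism commuting (resp. anti-commuting) with `g` commutes (resp.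
anti-commutes) with `g`. [folklore] -/
theorem symm_smul_of {W E : WeierstrassCurve ℚ} (ι : W.geomPoints ≃+ E.geomPoints)
    {g : absoluteGaloisGroup ℚ} (h : ∀ P, ι (g • P) = g • ι P) (Q : E.geomPoints) :
    ι.symm (g • Q) = g • ι.symm Q := by
  apply ι.injective
  rw [AddEquiv.apply_symm_apply, h, AddEquiv.apply_symm_apply]

/-- The inverse of an isomorphism anti-commuting with `g` anti-commutes with `g`. [folklore] -/
theorem symm_smul_neg_of {W E : WeierstrassCurve ℚ} (ι : W.geomPoints ≃+ E.geomPoints)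
    {g : absoluteGaloisGroup ℚ} (h : ∀ P, ι (g • P) = -(g • ι P)) (Q : E.geomPoints) :
    ι.symm (g • Q) = -(g • ι.symm Q) := by
  apply ι.injective
  rw [AddEquiv.apply_symm_apply, map_neg, h, AddEquiv.apply_symm_apply, neg_neg]

/-- **Transport of a twist endomorphism along a `ℚ̄`-isomorphism with a sign rule.** If
`ι : W(ℚ̄) ≃ E(ℚ̄)` commutes or anti-commutes with each `g ∈ Γ_ℚ` (e.g. an isomorphism defined
over a quadratic field onto a curve with `a₁ = a₃ = 0`), and `μ` is an additive endomorphism of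
`E(ℚ̄)` with `μ ∘ μ = [m]` commuting with the `g` fixing `s` and anti-commuting with those negating
`s`, then `ι⁻¹ ∘ μ ∘ ι` has the same three properties on `W(ℚ̄)`. [folklore] -/
theorem exists_transport_end {W E : WeierstrassCurve ℚ} (ι : W.geomPoints ≃+ E.geomPoints) {s : (AlgebraicClosure ℚ)}
    (hι : ∀ g : absoluteGaloisGroup ℚ, (∀ P, ι (g • P) = g • ι P) ∨ (∀ P, ι (g • P) = -(g • ι P)))
    {μ : AddMonoid.End E.geomPoints} {m : ℤ} (hμ : μ * μ = m)
    (h₁ : ∀ g : absoluteGaloisGroup ℚ, g • s = s → ∀ P, μ (g • P) = g • μ P)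
    (h₂ : ∀ g : absoluteGaloisGroup ℚ, g • s = -s → ∀ P, μ (g • P) = -(g • μ P)) :
    ∃ μ' : AddMonoid.End W.geomPoints, (∀ P, μ' (μ' P) = m • P) ∧
      (∀ g : absoluteGaloisGroup ℚ, g • s = s → ∀ P, μ' (g • P) = g • μ' P) ∧
      (∀ g : absoluteGaloisGroup ℚ, g • s = -s → ∀ P, μ' (g • P) = -(g • μ' P)) := by
  have hμμ : ∀ Q, μ (μ Q) = m • Q := fun Q =>
    (congrArg (fun φ : AddMonoid.End E.geomPoints => φ Q) hμ).trans (AddMonoid.End.intCast_apply m Q)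
  refine ⟨ι.symm.toAddMonoidHom.comp ((μ : E.geomPoints →+ E.geomPoints).comp ι.toAddMonoidHom),
    fun P => ?_, fun g hg P => ?_, fun g hg P => ?_⟩
  · change ι.symm (μ (ι (ι.symm (μ (ι P))))) = m • P
    rw [AddEquiv.apply_symm_apply, hμμ, map_zsmul, AddEquiv.symm_apply_apply]
  · change ι.symm (μ (ι (g • P))) = g • ι.symm (μ (ι P))
    rcases hι g with hιg | hιg
    · rw [hιg, h₁ g hg, symm_smul_of ι hιg]
    · rw [hιg, map_neg, h₁ g hg, map_neg, symm_smul_neg_of ι hιg, neg_neg]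
  · change ι.symm (μ (ι (g • P))) = -(g • ι.symm (μ (ι P)))
    rcases hι g with hιg | hιg
    · rw [hιg, h₂ g hg, map_neg, symm_smul_of ι hιg]
    · rw [hιg, map_neg, h₂ g hg, neg_neg, symm_smul_neg_of ι hιg]

/-- **A `ℚ̄`-isomorphism with a sign rule.** If `C • W = E` over `ℚ̄` (`E` with `a₁ = a₃ = 0`)
for a change of variables `C = (u, r, s, t)` with `r, s, t` fixed by `Γ_ℚ` and `g u = ± u` for
every `g ∈ Γ_ℚ`, then the induced `ι : W(ℚ̄) ≃ E(ℚ̄)` commutes or anti-commutes with each `g`.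
[folklore] -/
theorem exists_iso_of_variableChange {W E : WeierstrassCurve ℚ} (C : VariableChange (AlgebraicClosure ℚ))
    (hC : C • W.baseChange (AlgebraicClosure ℚ) = E.baseChange (AlgebraicClosure ℚ)) (ha₁ : E.a₁ = 0) (ha₃ : E.a₃ = 0)
    (hu : ∀ g : absoluteGaloisGroup ℚ, g • ((C.u : (AlgebraicClosure ℚ)ˣ) : (AlgebraicClosure ℚ)) = C.u ∨
      g • ((C.u : (AlgebraicClosure ℚ)ˣ) : (AlgebraicClosure ℚ)) = -C.u)
    (hr : ∀ g : absoluteGaloisGroup ℚ, g • C.r = C.r)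
    (hs : ∀ g : absoluteGaloisGroup ℚ, g • C.s = C.s)
    (ht : ∀ g : absoluteGaloisGroup ℚ, g • C.t = C.t) :
    ∃ ι : W.geomPoints ≃+ E.geomPoints,
      ∀ g : absoluteGaloisGroup ℚ, (∀ P, ι (g • P) = g • ι P) ∨ (∀ P, ι (g • P) = -(g • ι P)) := by
  refine ⟨(VariableChange.pointEquiv (W.baseChange (AlgebraicClosure ℚ)) C).trans (Affine.Point.congrEquiv hC),
    fun g => ?_⟩
  rcases hu g with hug | hug
  · exact Or.inl fun P => iso_smul C hC hug (hr g) (hs g) (ht g) P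
  · exact Or.inr fun P => iso_smul_neg C hC ha₁ ha₃ hug (hr g) (hs g) (ht g) P

/-- The quadratic twist of a model with `a₁ = a₃ = 0` is `[0, D a₂, 0, D² a₄, D³ a₆]`.
[folklore] -/
theorem quadraticTwist_eq_of_a₁_eq_zero (E : WeierstrassCurve ℚ) (ha₁ : E.a₁ = 0)
    (ha₃ : E.a₃ = 0) (D : ℚ) :
    E.quadraticTwist D = ⟨0, D * E.a₂, 0, D ^ 2 * E.a₄, D ^ 3 * E.a₆⟩ := by
  ext
  · rfl
  · simp only [quadraticTwist, b₂, ha₁]; ring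
  · rfl
  · simp only [quadraticTwist, b₄, ha₁, ha₃]; ring
  · simp only [quadraticTwist, b₆, ha₃]; ring

/-- **Every curve with the same `j`-invariant as `E` (`j ≠ 0, 1728`, `a₁ = a₃ = 0`) is
`ℚ̄`-isomorphic to `E` by an isomorphism commuting or anti-commuting with each `g ∈ Γ_ℚ`**: `W` is
`ℚ`-isomorphic to a quadratic twist `E^{(D)}` (the tree's
`exists_variableChange_eq_quadraticTwist_of_j_eq`, Silverman *AEC* X.5.4), and
`E^{(D)} ≅ E` over `ℚ(√D)` by `(u, r, s, t) = (√D, 0, 0, 0)`. [cite: SilvermanAEC2009, X.5 Prop. 5.4 and Cor. 5.4.1] -/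
theorem exists_iso_of_j_eq {W E : WeierstrassCurve ℚ} [W.IsElliptic] [E.IsElliptic]
    (hj : W.j = E.j) (h0 : E.j ≠ 0) (h1728 : E.j ≠ 1728) (ha₁ : E.a₁ = 0) (ha₃ : E.a₃ = 0) :
    ∃ ι : W.geomPoints ≃+ E.geomPoints,
      ∀ g : absoluteGaloisGroup ℚ, (∀ P, ι (g • P) = g • ι P) ∨ (∀ P, ι (g • P) = -(g • ι P)) := by
  obtain ⟨D, hD0, C₀, hC₀⟩ := exists_variableChange_eq_quadraticTwist_of_j_eq hj h0 h1728
  obtain ⟨sD, hsD⟩ := IsAlgClosed.exists_pow_nat_eq (algebraMap ℚ (AlgebraicClosure ℚ) D) two_pos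
  have hsD0 : sD ≠ 0 := by
    rintro rfl
    rw [zero_pow two_ne_zero, eq_comm, map_eq_zero] at hsD
    exact hD0 hsD
  set C₁ : VariableChange (AlgebraicClosure ℚ) := ⟨Units.mk0 sD hsD0, 0, 0, 0⟩ with hC₁
  set C : VariableChange (AlgebraicClosure ℚ) := C₁ * C₀.map (algebraMap ℚ (AlgebraicClosure ℚ)) with hCdef
  have hC : C • W.baseChange (AlgebraicClosure ℚ) = E.baseChange (AlgebraicClosure ℚ) := by
    rw [hCdef, mul_smul, ← VariableChange.baseChange_smul_eq W C₀ (AlgebraicClosure ℚ), hC₀,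
      quadraticTwist_eq_of_a₁_eq_zero E ha₁ ha₃ D]
    have hinv : ((Units.mk0 sD hsD0)⁻¹ : (AlgebraicClosure ℚ)ˣ) = Units.mk0 sD⁻¹ (inv_ne_zero hsD0) :=
      Units.ext (by simp)
    ext
    · simp [hC₁, baseChange, ha₁, variableChange_a₁]
    · simp only [hC₁, variableChange_a₂, baseChange, map_a₁, map_a₂, hinv, Units.val_mk0, map_mul,
        mul_zero, sub_zero, add_zero, zero_pow two_ne_zero]
      rw [← hsD]
      field_simp
      ring
    · simp [hC₁, baseChange, ha₃, variableChange_a₃]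
    · simp only [hC₁, variableChange_a₄, baseChange, map_a₁, map_a₂, map_a₃, map_a₄, hinv,
        Units.val_mk0, map_mul, map_pow, mul_zero, zero_mul, sub_zero, add_zero,
        zero_pow two_ne_zero]
      rw [← hsD]
      field_simp
    · simp only [hC₁, variableChange_a₆, baseChange, map_a₁, map_a₂, map_a₃, map_a₄, map_a₆, hinv,
        Units.val_mk0, map_mul, map_pow, mul_zero, zero_mul, sub_zero, add_zero,
        zero_pow two_ne_zero, zero_pow three_ne_zero]
      rw [← hsD]
      field_simp
  refine exists_iso_of_variableChange C hC ha₁ ha₃ (fun g => ?_) (fun g => ?_) (fun g => ?_)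
    (fun g => ?_)
  · have hCu : ((C.u : (AlgebraicClosure ℚ)ˣ) : (AlgebraicClosure ℚ)) = sD * algebraMap ℚ (AlgebraicClosure ℚ) ((C₀.u : ℚˣ) : ℚ) := rfl
    rw [hCu, smul_mul', smul_algebraMap]
    rcases smul_eq_self_or_eq_neg hsD g with hg | hg
    · left
      rw [hg]
    · right
      rw [hg, neg_mul]
  · have hCr : C.r = 0 * _ + algebraMap ℚ (AlgebraicClosure ℚ) C₀.r := rfl
    rw [hCr, zero_mul, zero_add, smul_algebraMap]
  · have hCs : C.s = _ * 0 + algebraMap ℚ (AlgebraicClosure ℚ) C₀.s := rfl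
    rw [hCs, mul_zero, zero_add, smul_algebraMap]
  · have hCt : C.t = 0 * _ + 0 * _ * _ + algebraMap ℚ (AlgebraicClosure ℚ) C₀.t := rfl
    rw [hCt, zero_mul, zero_mul, zero_mul, zero_add, zero_add, smul_algebraMap]

end Transport

end Literature.NumberTheory.EllipticCurves.DeuringLadic

namespace Literature.NumberTheory.EllipticCurves.DeuringLadic

/-! ### Algebra: from `m (a² - 4p) = r²` to `π ∈ 𝓞_K` -/

section Algebra

/-- **Hasse's bound** for the reduction of a globally minimal model at a good prime:
`a_p² ≤ 4p` (the tree's `abs_natCard_point_sub_le_of_card_eq_prime`, Manin's elementary proof of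
Silverman, *AEC*, Thm. V.1.1). [cite: SilvermanAEC2009, Thm. V.1.1] -/
theorem frobeniusTrace_sq_le (W : WeierstrassCurve ℚ) [W.IsElliptic] [W.IsGloballyMinimal]
    {p : ℕ} (hp : p.Prime) (hΔ : ¬ (p : ℤ) ∣ WeierstrassCurve.minimalDiscriminantInt W) :
    W.frobeniusTrace p ^ 2 ≤ 4 * p := by
  haveI : Fact p.Prime := ⟨hp⟩
  haveI := isElliptic_reductionModPrime W hΔ
  have h := (reductionModPrime W p).abs_natCard_point_sub_le_of_card_eq_prime hp (ZMod.card p)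
  rw [ZMod.card p] at h
  have h0 : (0 : ℝ) ≤ 2 * Real.sqrt p := by positivity
  have h2 : ((Nat.card (reductionModPrime W p).toAffine.Point : ℝ) - (p + 1)) ^ 2 ≤
      (2 * Real.sqrt p) ^ 2 := by
    rw [← sq_abs]
    exact pow_le_pow_left₀ (abs_nonneg _) h 2
  rw [mul_pow, Real.sq_sqrt (Nat.cast_nonneg p)] at h2
  have h3 : ((W.frobeniusTrace p : ℤ) : ℝ) ^ 2 ≤ 4 * p := by
    rw [WeierstrassCurve.frobeniusTrace, reductionPointCount_eq_natCard_point]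
    push_cast
    nlinarith [h2]
  exact_mod_cast h3

/-- From `-q (a² - 4p) = r²` with `q` prime: `a² - 4p = -q w²`. [folklore] -/
theorem exists_sq_sub_eq_neg_prime_mul_sq {q : ℕ} (hq : q.Prime) {a r : ℤ} {p : ℕ}
    (h : -(q : ℤ) * (a ^ 2 - 4 * p) = r ^ 2) : ∃ w : ℤ, a ^ 2 - 4 * p = -(q : ℤ) * w ^ 2 := by
  have hq' : Prime (q : ℤ) := Nat.prime_iff_prime_int.mp hq
  have hdvd : (q : ℤ) ∣ r ^ 2 := ⟨-(a ^ 2 - 4 * p), by linear_combination -h⟩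
  obtain ⟨w, rfl⟩ := hq'.dvd_of_dvd_pow hdvd
  refine ⟨w, ?_⟩
  have hq0 : (q : ℤ) ≠ 0 := by exact_mod_cast hq.ne_zero
  have : (q : ℤ) * (a ^ 2 - 4 * p + q * w ^ 2) = 0 := by linear_combination -h
  linear_combination (mul_eq_zero.mp this).resolve_left hq0

/-- From `-2 (a² - 4p) = r²`: `a² - 4p = -8 w²` (`r`, then `a`, then `r/2` are even). [folklore] -/
theorem exists_sq_sub_eq_neg_eight_mul_sq {a r : ℤ} {p : ℕ} (h : -2 * (a ^ 2 - 4 * p) = r ^ 2) :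
    ∃ w : ℤ, a ^ 2 - 4 * p = -8 * w ^ 2 := by
  have h2r : (2 : ℤ) ∣ r ^ 2 := ⟨-(a ^ 2 - 4 * p), by linear_combination -h⟩
  obtain ⟨r₁, rfl⟩ := Int.prime_two.dvd_of_dvd_pow h2r
  have h1 : a ^ 2 - 4 * p = -2 * r₁ ^ 2 := by linarith
  have h2a : (2 : ℤ) ∣ a ^ 2 := ⟨2 * p - r₁ ^ 2, by linear_combination h1⟩
  obtain ⟨a₁, rfl⟩ := Int.prime_two.dvd_of_dvd_pow h2a
  have h2r₁ : (2 : ℤ) ∣ r₁ ^ 2 := ⟨p - a₁ ^ 2, by linarith⟩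
  obtain ⟨w, rfl⟩ := Int.prime_two.dvd_of_dvd_pow h2r₁
  exact ⟨w, by linear_combination h1⟩

/-- **`a_p = π + π̄`, `p = ππ̄` from `a_p² - 4p = d w²`.** For `d` one of the nine
class-number-one discriminants and integers `a, w` with `a² - 4p = d w²`, the element
`π = (a + w√d)/2 = (a - dw)/2 + w ω_d` lies in `ℤ[ω_d]` (`a ≡ dw (mod 2)`), has norm
`ππ̄ = (a² - dw²)/4 = p` and trace `π + π̄ = a`. Cox, *Primes of the form x² + ny²*, (7.1) and
Lemma 7.2. [folklore] -/
theorem exists_pi_of_sq_sub_eq {d : ℤ} (hd : d ∈ cmDiscrs) {a w : ℤ} {p : ℕ}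
    (h : a ^ 2 - 4 * p = d * w ^ 2) :
    ∃ π : ℂ, π ∈ cmRing d ∧ π * conj π = p ∧ (a : ℂ) = π + conj π := by
  obtain ⟨hdneg, c, hc⟩ := neg_and_exists_of_mem_cmDiscrs hd
  -- `a ≡ dw (mod 2)`: `a = 2A + dw`
  obtain ⟨A, hA⟩ := two_dvd_sub_of_sq_sub_mul_sq (U := a) (B := w) (d := d) (N := (p : ℤ))
    (by linear_combination (-1 : ℤ) * h)
  have ha : a = 2 * A + d * w := by linarith
  subst ha
  have e₃ := cmGen_sq hdneg.le hc
  have h' : ((2 * A + d * w : ℤ) : ℂ) ^ 2 - 4 * (p : ℂ) = (d : ℂ) * (w : ℂ) ^ 2 := by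
    exact_mod_cast congrArg (fun z : ℤ => (z : ℂ)) h
  have hc' : (d : ℂ) * (d - 1) = 4 * c := by exact_mod_cast hc
  push_cast at h'
  refine ⟨(A : ℂ) + (w : ℂ) * cmGen d, (mem_cmRing_iff hdneg.le hc).mpr ⟨A, w, rfl⟩, ?_, ?_⟩
  · rw [map_add, map_mul, map_intCast, map_intCast, conj_cmGen]
    linear_combination (-(w : ℂ) ^ 2) * e₃ + (1 / 4 : ℂ) * h' - ((w : ℂ) ^ 2 / 4) * hc'
  · rw [map_add, map_mul, map_intCast, map_intCast, conj_cmGen]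
    push_cast
    ring

end Algebra

/-! ### The engine: a `ℚ`-isogeny to the twist yields `m (a_p² - 4p) = r²`, `|m| = deg` -/

section Engine

/-- `-2` is a square modulo an odd `p` when `-8` is. [folklore] -/
theorem isSquare_neg_two_of_isSquare_neg_eight {p : ℕ} (hp : p.Prime) (h2 : p ≠ 2)
    (h : IsSquare ((-8 : ℤ) : ZMod p)) : IsSquare ((-2 : ℤ) : ZMod p) := by
  haveI : Fact p.Prime := ⟨hp⟩
  have h2' : (2 : ZMod p) ≠ 0 := by
    intro h0
    have : ((2 : ℕ) : ZMod p) = 0 := by exact_mod_cast h0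
    rw [ZMod.natCast_eq_zero_iff] at this
    exact h2 ((Nat.prime_dvd_prime_iff_eq hp Nat.prime_two).mp this)
  obtain ⟨y, hy⟩ := h
  refine ⟨y * 2⁻¹, ?_⟩
  have : (y * 2⁻¹) * (y * 2⁻¹) = (y * y) * (2⁻¹) ^ 2 := by ring
  rw [this, ← hy]
  push_cast
  field_simp
  norm_num

/-- **The engine of the proof for `j ≠ 0, 1728`.** Let `E/ℚ` be an elliptic curve with
`a₁ = a₃ = 0` and `λ : E → E'` a `ℚ`-isogeny of degree `N` onto the model
`E' = [0, D a₂, 0, D² a₄, D³ a₆]` of the quadratic twist of `E` by an integer `D < 0`; let `W/ℚ`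
be any globally minimal elliptic curve with `j(W) = j(E) ≠ 0, 1728`, and `p ∤ Δ_W` an odd prime
with `p ∤ D` and `D` a square modulo `p`. Then there is an integer `m` with `|m| = N` such that
`m (a_p(W)² - 4p)` is a non-zero square: `μ = τ⁻¹ ∘ λ` (`exists_twist_end`) has `μ ∘ μ = [m]`
(`exists_mul_self_eq_intCast`, `natAbs_eq_of_mul_self_eq_intCast`), it transports to `W(ℚ̄)` along
a `ℚ̄`-isomorphism commuting with `Γ_ℚ` up to sign (`exists_iso_of_j_eq`,
`exists_transport_end`), and the `ℓ`-adic core theorem `exists_mul_frobeniusTrace_sq_sub_eq_sq`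
applies. [cite: SilvermanAEC2009, C.21 Remark 21.3, III.§7 and X.5 Prop. 5.4] -/
theorem exists_natAbs_eq_and_mul_eq_sq {E E' : WeierstrassCurve ℚ} [E.IsElliptic] [E'.IsElliptic]
    (lam : Isogeny E E') {N : ℕ} (hN : lam.degree = N) (ha₁ : E.a₁ = 0) (ha₃ : E.a₃ = 0)
    {D : ℤ} (hD : D < 0) (hE' : E' = ⟨0, (D : ℚ) * E.a₂, 0, (D : ℚ) ^ 2 * E.a₄, (D : ℚ) ^ 3 * E.a₆⟩)
    (W : WeierstrassCurve ℚ) [W.IsElliptic] [W.IsGloballyMinimal] (hj : W.j = E.j) (h0 : E.j ≠ 0)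
    (h1728 : E.j ≠ 1728) {p : ℕ} (hp : p.Prime) (h2 : p ≠ 2)
    (hΔ : ¬ (p : ℤ) ∣ WeierstrassCurve.minimalDiscriminantInt W) (hpD : ¬ (p : ℤ) ∣ D)
    (hsq : IsSquare ((D : ℤ) : ZMod p)) :
    ∃ m : ℤ, m.natAbs = N ∧ ∃ r : ℤ, r ≠ 0 ∧ m * (W.frobeniusTrace p ^ 2 - 4 * p) = r ^ 2 := by
  -- `s = √D ∈ ℚ̄`
  obtain ⟨s, hs⟩ := IsAlgClosed.exists_pow_nat_eq ((D : ℤ) : (AlgebraicClosure ℚ)) two_pos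
  have hsQ : s ^ 2 = algebraMap ℚ (AlgebraicClosure ℚ) (D : ℚ) := by rw [hs, map_intCast]
  have hD0 : D ≠ 0 := hD.ne
  have hs0 : s ≠ 0 := by
    rintro rfl
    rw [zero_pow two_ne_zero, eq_comm, Int.cast_eq_zero] at hs
    exact hD0 hs
  -- the twisting change of variables `C = (s⁻¹, 0, 0, 0)`: `C • E = E'` over `ℚ̄`
  set C : VariableChange (AlgebraicClosure ℚ) := ⟨Units.mk0 s⁻¹ (inv_ne_zero hs0), 0, 0, 0⟩ with hCdef
  have hCu : ((C.u : (AlgebraicClosure ℚ)ˣ) : (AlgebraicClosure ℚ)) = s⁻¹ := rfl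
  have hinv : ((Units.mk0 s⁻¹ (inv_ne_zero hs0))⁻¹ : (AlgebraicClosure ℚ)ˣ) = Units.mk0 s hs0 :=
    Units.ext (by simp)
  have hC : C • E.baseChange (AlgebraicClosure ℚ) = E'.baseChange (AlgebraicClosure ℚ) := by
    rw [hE']
    ext
    · simp [hCdef, baseChange, ha₁, variableChange_a₁]
    · simp only [hCdef, variableChange_a₂, baseChange, map_a₁, map_a₂, hinv, Units.val_mk0, map_mul,
        map_intCast, ha₁, map_zero, mul_zero, sub_zero, add_zero, zero_pow two_ne_zero, ← hs]
    · simp [hCdef, baseChange, ha₃, variableChange_a₃]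
    · simp only [hCdef, variableChange_a₄, baseChange, map_a₁, map_a₂, map_a₃, map_a₄, hinv,
        Units.val_mk0, map_mul, map_pow, map_intCast, ha₁, ha₃, map_zero, mul_zero, zero_mul,
        sub_zero, add_zero, zero_pow two_ne_zero, ← hs]
      ring
    · simp only [hCdef, variableChange_a₆, baseChange, map_a₁, map_a₂, map_a₃, map_a₄, map_a₆, hinv,
        Units.val_mk0, map_mul, map_pow, map_intCast, ha₁, ha₃, map_zero, mul_zero, zero_mul,
        sub_zero, add_zero, zero_pow two_ne_zero, zero_pow three_ne_zero, ← hs]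
      ring
  have ha₁' : E'.a₁ = 0 := by rw [hE']
  have ha₃' : E'.a₃ = 0 := by rw [hE']
  -- the twist endomorphism `μ = τ⁻¹ ∘ λ` of `E(ℚ̄)`
  obtain ⟨μ, halg, hsurj, hker, h₁, h₂⟩ := exists_twist_end lam ha₁' ha₃' C hC hCu rfl rfl rfl
  obtain ⟨m, hμm⟩ := exists_mul_self_eq_intCast E hsQ halg h₁ h₂
  have hμμ : ∀ P, μ (μ P) = m • P := fun P =>
    (congrArg (fun φ : AddMonoid.End E.geomPoints => φ P) hμm).trans (AddMonoid.End.intCast_apply m P)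
  have hm0 : m ≠ 0 := by
    rintro rfl
    obtain ⟨P, hP⟩ := exists_ne (0 : E.geomPoints)
    obtain ⟨Q, rfl⟩ := hsurj P
    obtain ⟨R, rfl⟩ := hsurj Q
    exact hP (by rw [hμμ, zero_smul])
  have hkerN : Nat.card (μ : E.geomPoints →+ E.geomPoints).ker = N := by
    rw [← hN]
    unfold Isogeny.degree
    congr 2
    ext P
    exact hker P
  have hmN : m.natAbs = N := natAbs_eq_of_mul_self_eq_intCast E hsurj hkerN hμm hm0
  -- transport to `W(ℚ̄)` and apply the `ℓ`-adic core
  obtain ⟨ι, hι⟩ := exists_iso_of_j_eq hj h0 h1728 ha₁ ha₃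
  obtain ⟨μ', hμ'μ', h₁', h₂'⟩ := exists_transport_end ι hι hμm h₁ h₂
  obtain ⟨r, hr0, hr⟩ := exists_mul_frobeniusTrace_sq_sub_eq_sq W hp h2 hΔ hD hpD hsq hs μ' hm0
    hμ'μ' h₁' h₂'
  exact ⟨m, hmN, r, hr0, hr⟩

/-- **`a_p = π + π̄` from a `ℚ`-isogeny of prime degree `q` to the twist by `-q`.** In the
setting of `exists_natAbs_eq_and_mul_eq_sq` with `D = -q`, `N = q` prime and `-q ∈ cmDiscrs`:
Hasse's bound forces `m = -q`, so `a_p² - 4p = -q w²` and `π = (a_p + w√-q)/2 ∈ 𝓞_{ℚ(√-q)}`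
has `ππ̄ = p`, `π + π̄ = a_p`. [cite: Cox2013, Thm. 14.16 (§14.C)] -/
theorem exists_pi_of_isogeny_prime {E E' : WeierstrassCurve ℚ} [E.IsElliptic] [E'.IsElliptic]
    (lam : Isogeny E E') {q : ℕ} (hq : q.Prime) (hN : lam.degree = q) (ha₁ : E.a₁ = 0)
    (ha₃ : E.a₃ = 0)
    (hE' : E' = ⟨0, ((-(q : ℤ) : ℤ) : ℚ) * E.a₂, 0, ((-(q : ℤ) : ℤ) : ℚ) ^ 2 * E.a₄,
      ((-(q : ℤ) : ℤ) : ℚ) ^ 3 * E.a₆⟩)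
    (hd : (-(q : ℤ)) ∈ cmDiscrs)
    (W : WeierstrassCurve ℚ) [W.IsElliptic] [W.IsGloballyMinimal] (hj : W.j = E.j) (h0 : E.j ≠ 0)
    (h1728 : E.j ≠ 1728) {p : ℕ} (hp : p.Prime) (h2 : p ≠ 2)
    (hΔ : ¬ (p : ℤ) ∣ WeierstrassCurve.minimalDiscriminantInt W) (hpq : ¬ (p : ℤ) ∣ -(q : ℤ))
    (hsq : IsSquare ((-(q : ℤ) : ℤ) : ZMod p)) :
    ∃ π : ℂ, π ∈ cmRing (-(q : ℤ)) ∧ π * conj π = p ∧ (W.frobeniusTrace p : ℂ) = π + conj π := by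
  have hD : (-(q : ℤ)) < 0 := by
    have := hq.pos
    omega
  obtain ⟨m, hmq, r, hr0, hr⟩ := exists_natAbs_eq_and_mul_eq_sq lam hN ha₁ ha₃ hD hE' W hj h0 h1728
    hp h2 hΔ hpq hsq
  have hH := frobeniusTrace_sq_le W hp hΔ
  have hne := sq_sub_four_mul_prime_ne_zero (W.frobeniusTrace p) hp
  have hneg : W.frobeniusTrace p ^ 2 - 4 * p < 0 := lt_of_le_of_ne (by linarith) hne
  have hm : m = -(q : ℤ) := by
    rcases Int.natAbs_eq m with h | h
    · exfalso
      have : 0 < r ^ 2 := by positivity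
      rw [← hr] at this
      have hm0 : (0 : ℤ) ≤ m := by rw [h]; exact Int.natCast_nonneg _
      nlinarith
    · rw [h, hmq]
  rw [hm] at hr
  obtain ⟨w, hw⟩ := exists_sq_sub_eq_neg_prime_mul_sq hq hr
  exact exists_pi_of_sq_sub_eq hd hw

/-- **`a_p = π + π̄` for `j = 8000` (`d_K = -8`)** from the `2`-isogeny
`E₈ : y² = x³ + 4x² + 2x → y² = x³ - 8x² + 8x` (Silverman *AEC* III.4.5), the twist of `E₈` by
`-2`: here `m = -2` and `a_p² - 4p = -8 w²`. [cite: Cox2013, Thm. 14.16 (§14.C)] -/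
theorem exists_pi_of_j_eq_8000 (W : WeierstrassCurve ℚ) [W.IsElliptic] [W.IsGloballyMinimal]
    (hj : W.j = 8000) {p : ℕ} (hp : p.Prime) (h2 : p ≠ 2)
    (hΔ : ¬ (p : ℤ) ∣ WeierstrassCurve.minimalDiscriminantInt W)
    (hsq : IsSquare ((-8 : ℤ) : ZMod p)) :
    ∃ π : ℂ, π ∈ cmRing (-8) ∧ π * conj π = p ∧ (W.frobeniusTrace p : ℂ) = π + conj π := by
  have hE' : cm8.twoIsogenyCodomain =
      ⟨0, ((-2 : ℤ) : ℚ) * cm8.a₂, 0, ((-2 : ℤ) : ℚ) ^ 2 * cm8.a₄, ((-2 : ℤ) : ℚ) ^ 3 * cm8.a₆⟩ := by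
    rw [twoIsogenyCodomain_mk]
    ext <;> norm_num [cm8]
  have hp2 : ¬ (p : ℤ) ∣ (-2 : ℤ) := by
    intro h
    have : (p : ℤ) ∣ 2 := (dvd_neg.mp h)
    have h' : p ∣ 2 := by exact_mod_cast this
    exact h2 ((Nat.prime_dvd_prime_iff_eq hp Nat.prime_two).mp h')
  obtain ⟨m, hmq, r, hr0, hr⟩ := exists_natAbs_eq_and_mul_eq_sq cm8.twoIsogeny (degree_twoIsogeny cm8)
    rfl rfl (by norm_num : (-2 : ℤ) < 0) hE' W (by rw [hj, j_cm8]) (by rw [j_cm8]; norm_num)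
    (by rw [j_cm8]; norm_num) hp h2 hΔ hp2 (isSquare_neg_two_of_isSquare_neg_eight hp h2 hsq)
  have hH := frobeniusTrace_sq_le W hp hΔ
  have hne := sq_sub_four_mul_prime_ne_zero (W.frobeniusTrace p) hp
  have hneg : W.frobeniusTrace p ^ 2 - 4 * p < 0 := lt_of_le_of_ne (by linarith) hne
  have hm : m = -2 := by
    rcases Int.natAbs_eq m with h | h
    · exfalso
      have : 0 < r ^ 2 := by positivity
      rw [← hr] at this
      have hm0 : (0 : ℤ) ≤ m := by rw [h]; exact Int.natCast_nonneg _
      nlinarith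
    · rw [h, hmq]; rfl
  rw [hm] at hr
  obtain ⟨w, hw⟩ := exists_sq_sub_eq_neg_eight_mul_sq hr
  exact exists_pi_of_sq_sub_eq (d := -8) (by decide) hw

end Engine

/-! ### The six CM curves with a certified prime-degree isogeny to their twist -/

section Cases

open Polynomial Literature.NumberTheory.EllipticCurves.PolyCert
  Literature.NumberTheory.EllipticCurves.CMIsogenyCert

/-- **The isogeny of a checked certificate and its degree.** A kernel-checked certificate `c`
(fast check, coprimality of `U, h` certified modulo a prime) between elliptic curves `E, E'` over
`ℚ` with the certified coefficients yields a `ℚ`-isogeny `E → E'` of degree `deg U = |U| - 1`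
(Silverman, *AEC*, Thm. III.4.8 in the tree's form `IsogenyFormula.toIsogeny`, and
`#ker = deg U`, `IsogenyFormula.degree_toIsogeny`, *AEC* III.4.10(a),(c)).
[cite: SilvermanAEC2009, Thm. III.4.8 and Thm. III.4.10(a),(c)] -/
theorem exists_isogeny_degree_eq_of_cert {E E' : WeierstrassCurve ℚ} [E.IsElliptic] [E'.IsElliptic]
    (c : IsogenyCert) {k : ℕ} (hc : c.checkFast k = true) (d : CoprimeCert) {k' : ℕ}
    (hd : c.checkCoprime d k' = true) (hℓ : d.ℓ.Prime)
    (h₁ : E = ⟨c.a₁, c.a₂, c.a₃, c.a₄, c.a₆⟩) (h₂ : E' = ⟨c.a₁', c.a₂', c.a₃', c.a₄', c.a₆'⟩) :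
    ∃ lam : Isogeny E E', lam.degree = c.U.length - 1 := by
  set φ := c.toFormula (IsogenyCert.check_of_checkFast hc) E E' h₁ h₂ with hφ
  have hcop : IsCoprime (φ.U.map (algebraMap ℚ (AlgebraicClosure ℚ)))
      (φ.h.map (algebraMap ℚ (AlgebraicClosure ℚ))) := by
    change IsCoprime ((ofList c.U : ℚ[X]).map (algebraMap ℚ (AlgebraicClosure ℚ)))
      ((ofList c.h : ℚ[X]).map (algebraMap ℚ (AlgebraicClosure ℚ)))
    rw [IsogenyCert.map_ofList, IsogenyCert.map_ofList]
    exact IsogenyCert.isCoprime_of_checkCoprime hd hℓ _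
  refine ⟨φ.toIsogeny, ?_⟩
  rw [φ.degree_toIsogeny hcop]
  change (ofList c.U : ℚ[X]).natDegree = c.U.length - 1
  exact IsogenyCert.natDegree_ofList_eq c.U (IsogenyCert.checkFast_spec hc).2.2.2.2.2.1

/-- The modulus of `cert7Cop` is the prime `10007`. [folklore] -/
theorem cert7Cop_ℓ : cert7Cop.ℓ = 10007 := rfl

/-- **Deuring's `a_p = π + π̄` for `j = -3375` (`d_K = -7`)**, from the certified `7`-isogeny
`cert7` of the short model `[0, 0, 0, -2835, -71442]` onto its twist by `-7`.
[cite: Cox2013, Thm. 14.16 (§14.C)] -/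
theorem exists_pi_of_j_eq_neg3375 (W : WeierstrassCurve ℚ) [W.IsElliptic] [W.IsGloballyMinimal]
    (hj : W.j = -3375) {p : ℕ} (hp : p.Prime) (h2 : p ≠ 2)
    (hΔ : ¬ (p : ℤ) ∣ WeierstrassCurve.minimalDiscriminantInt W) (hpd : ¬ (p : ℤ) ∣ -7)
    (hsq : IsSquare ((-7 : ℤ) : ZMod p)) :
    ∃ π : ℂ, π ∈ cmRing (-7) ∧ π * conj π = p ∧ (W.frobeniusTrace p : ℂ) = π + conj π := by
  haveI := isElliptic_cert7
  haveI := isElliptic_cert7'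
  obtain ⟨lam, hlam⟩ := exists_isogeny_degree_eq_of_cert
    (E := (⟨0, 0, 0, -2835, -71442⟩ : WeierstrassCurve ℚ))
    (E' := (⟨0, 0, 0, -138915, 24504606⟩ : WeierstrassCurve ℚ)) cert7 checkFast_cert7 cert7Cop
    checkCoprime_cert7 (by rw [cert7Cop_ℓ]; norm_num)
    (by rw [cert7_a₁, cert7_a₂, cert7_a₃, cert7_a₄, cert7_a₆]; norm_num)
    (by rw [cert7_a₁', cert7_a₂', cert7_a₃', cert7_a₄', cert7_a₆']; norm_num)
  rw [show cert7.U.length - 1 = 7 from Nat.add_one_sub_one 7] at hlam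
  have h := exists_pi_of_isogeny_prime lam (by norm_num) hlam rfl rfl (by ext <;> norm_num)
    (by decide) W (by rw [hj, j_cert7 rfl]) (by rw [j_cert7 rfl]; norm_num)
    (by rw [j_cert7 rfl]; norm_num) hp h2 hΔ (by exact_mod_cast hpd) (by exact_mod_cast hsq)
  exact_mod_cast h

/-- **Deuring's `a_p = π + π̄` for `j = -32768` (`d_K = -11`)**, from the certified `11`-isogeny
`cert11` of `[0, 0, 0, -9504, 365904]` onto its twist by `-11`. [cite: Cox2013, Thm. 14.16 (§14.C)] -/
theorem exists_pi_of_j_eq_neg32768 (W : WeierstrassCurve ℚ) [W.IsElliptic] [W.IsGloballyMinimal]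
    (hj : W.j = -32768) {p : ℕ} (hp : p.Prime) (h2 : p ≠ 2)
    (hΔ : ¬ (p : ℤ) ∣ WeierstrassCurve.minimalDiscriminantInt W) (hpd : ¬ (p : ℤ) ∣ -11)
    (hsq : IsSquare ((-11 : ℤ) : ZMod p)) :
    ∃ π : ℂ, π ∈ cmRing (-11) ∧ π * conj π = p ∧ (W.frobeniusTrace p : ℂ) = π + conj π := by
  haveI := isElliptic_cert11
  haveI := isElliptic_cert11'
  obtain ⟨lam, hlam⟩ := exists_isogeny_degree_eq_of_cert
    (E := (⟨0, 0, 0, -9504, 365904⟩ : WeierstrassCurve ℚ))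
    (E' := (⟨0, 0, 0, -1149984, -487018224⟩ : WeierstrassCurve ℚ)) cert11 checkFast_cert11
    cert11Cop checkCoprime_cert11 (by rw [cert11Cop_ℓ]; norm_num)
    (by rw [cert11_a₁, cert11_a₂, cert11_a₃, cert11_a₄, cert11_a₆]; norm_num)
    (by rw [cert11_a₁', cert11_a₂', cert11_a₃', cert11_a₄', cert11_a₆']; norm_num)
  rw [show cert11.U.length - 1 = 11 from Nat.add_one_sub_one 11] at hlam
  have h := exists_pi_of_isogeny_prime lam (by norm_num) hlam rfl rfl (by ext <;> norm_num)
    (by decide) W (by rw [hj, j_cert11 rfl]) (by rw [j_cert11 rfl]; norm_num)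
    (by rw [j_cert11 rfl]; norm_num) hp h2 hΔ (by exact_mod_cast hpd) (by exact_mod_cast hsq)
  exact_mod_cast h

/-- **Deuring's `a_p = π + π̄` for `j = -884736` (`d_K = -19`)**, from the certified `19`-isogeny
`cert19` of `[0, 0, 0, -608, 5776]` onto its twist by `-19`. [cite: Cox2013, Thm. 14.16 (§14.C)] -/
theorem exists_pi_of_j_eq_neg884736 (W : WeierstrassCurve ℚ) [W.IsElliptic] [W.IsGloballyMinimal]
    (hj : W.j = -884736) {p : ℕ} (hp : p.Prime) (h2 : p ≠ 2)
    (hΔ : ¬ (p : ℤ) ∣ WeierstrassCurve.minimalDiscriminantInt W) (hpd : ¬ (p : ℤ) ∣ -19)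
    (hsq : IsSquare ((-19 : ℤ) : ZMod p)) :
    ∃ π : ℂ, π ∈ cmRing (-19) ∧ π * conj π = p ∧ (W.frobeniusTrace p : ℂ) = π + conj π := by
  haveI := isElliptic_cert19
  haveI := isElliptic_cert19'
  obtain ⟨lam, hlam⟩ := exists_isogeny_degree_eq_of_cert
    (E := (⟨0, 0, 0, -608, 5776⟩ : WeierstrassCurve ℚ))
    (E' := (⟨0, 0, 0, -219488, -39617584⟩ : WeierstrassCurve ℚ)) cert19 checkFast_cert19
    cert19Cop checkCoprime_cert19 (by rw [cert19Cop_ℓ]; norm_num)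
    (by rw [cert19_a₁, cert19_a₂, cert19_a₃, cert19_a₄, cert19_a₆]; norm_num)
    (by rw [cert19_a₁', cert19_a₂', cert19_a₃', cert19_a₄', cert19_a₆']; norm_num)
  rw [show cert19.U.length - 1 = 19 from Nat.add_one_sub_one 19] at hlam
  have h := exists_pi_of_isogeny_prime lam (by norm_num) hlam rfl rfl (by ext <;> norm_num)
    (by decide) W (by rw [hj, j_cert19 rfl]) (by rw [j_cert19 rfl]; norm_num)
    (by rw [j_cert19 rfl]; norm_num) hp h2 hΔ (by exact_mod_cast hpd) (by exact_mod_cast hsq)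
  exact_mod_cast h

/-- **Deuring's `a_p = π + π̄` for `j = -884736000` (`d_K = -43`)**, from the certified
`43`-isogeny `cert43` of `[0, 0, 0, -13760, 621264]` onto its twist by `-43`.
[cite: Cox2013, Thm. 14.16 (§14.C)] -/
theorem exists_pi_of_j_eq_neg884736000 (W : WeierstrassCurve ℚ) [W.IsElliptic]
    [W.IsGloballyMinimal] (hj : W.j = -884736000) {p : ℕ} (hp : p.Prime) (h2 : p ≠ 2)
    (hΔ : ¬ (p : ℤ) ∣ WeierstrassCurve.minimalDiscriminantInt W) (hpd : ¬ (p : ℤ) ∣ -43)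
    (hsq : IsSquare ((-43 : ℤ) : ZMod p)) :
    ∃ π : ℂ, π ∈ cmRing (-43) ∧ π * conj π = p ∧ (W.frobeniusTrace p : ℂ) = π + conj π := by
  haveI := isElliptic_cert43
  haveI := isElliptic_cert43'
  obtain ⟨lam, hlam⟩ := exists_isogeny_degree_eq_of_cert
    (E := (⟨0, 0, 0, -13760, 621264⟩ : WeierstrassCurve ℚ))
    (E' := (⟨0, 0, 0, -25442240, -49394836848⟩ : WeierstrassCurve ℚ)) cert43 checkFast_cert43
    cert43Cop checkCoprime_cert43 (by rw [cert43Cop_ℓ]; norm_num)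
    (by rw [cert43_a₁, cert43_a₂, cert43_a₃, cert43_a₄, cert43_a₆]; norm_num)
    (by rw [cert43_a₁', cert43_a₂', cert43_a₃', cert43_a₄', cert43_a₆']; norm_num)
  rw [show cert43.U.length - 1 = 43 from Nat.add_one_sub_one 43] at hlam
  have h := exists_pi_of_isogeny_prime lam (by norm_num) hlam rfl rfl (by ext <;> norm_num)
    (by decide) W (by rw [hj, j_cert43 rfl]) (by rw [j_cert43 rfl]; norm_num)
    (by rw [j_cert43 rfl]; norm_num) hp h2 hΔ (by exact_mod_cast hpd) (by exact_mod_cast hsq)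
  exact_mod_cast h

/-- **Deuring's `a_p = π + π̄` for `j = -147197952000` (`d_K = -67`)**, from the certified
`67`-isogeny `cert67` of `[0, 0, 0, -117920, 15585808]` onto its twist by `-67`.
[cite: Cox2013, Thm. 14.16 (§14.C)] -/
theorem exists_pi_of_j_eq_neg147197952000 (W : WeierstrassCurve ℚ) [W.IsElliptic]
    [W.IsGloballyMinimal] (hj : W.j = -147197952000) {p : ℕ} (hp : p.Prime) (h2 : p ≠ 2)
    (hΔ : ¬ (p : ℤ) ∣ WeierstrassCurve.minimalDiscriminantInt W) (hpd : ¬ (p : ℤ) ∣ -67)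
    (hsq : IsSquare ((-67 : ℤ) : ZMod p)) :
    ∃ π : ℂ, π ∈ cmRing (-67) ∧ π * conj π = p ∧ (W.frobeniusTrace p : ℂ) = π + conj π := by
  haveI := isElliptic_cert67
  haveI := isElliptic_cert67'
  obtain ⟨lam, hlam⟩ := exists_isogeny_degree_eq_of_cert
    (E := (⟨0, 0, 0, -117920, 15585808⟩ : WeierstrassCurve ℚ))
    (E' := (⟨0, 0, 0, -529342880, -4687634371504⟩ : WeierstrassCurve ℚ)) cert67 checkFast_cert67
    cert67Cop checkCoprime_cert67 (by rw [cert67Cop_ℓ]; norm_num)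
    (by rw [cert67_a₁, cert67_a₂, cert67_a₃, cert67_a₄, cert67_a₆]; norm_num)
    (by rw [cert67_a₁', cert67_a₂', cert67_a₃', cert67_a₄', cert67_a₆']; norm_num)
  rw [show cert67.U.length - 1 = 67 from Nat.add_one_sub_one 67] at hlam
  have h := exists_pi_of_isogeny_prime lam (by norm_num) hlam rfl rfl (by ext <;> norm_num)
    (by decide) W (by rw [hj, j_cert67 rfl]) (by rw [j_cert67 rfl]; norm_num)
    (by rw [j_cert67 rfl]; norm_num) hp h2 hΔ (by exact_mod_cast hpd) (by exact_mod_cast hsq)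
  exact_mod_cast h

/-- **Deuring's `a_p = π + π̄` for `j = -262537412640768000` (`d_K = -163`)**, from the
certified `163`-isogeny `cert163` of `[0, 0, 0, -34790720, 78984748304]` onto its twist by
`-163`. [cite: Cox2013, Thm. 14.16 (§14.C)] -/
theorem exists_pi_of_j_eq_neg262537412640768000 (W : WeierstrassCurve ℚ) [W.IsElliptic]
    [W.IsGloballyMinimal] (hj : W.j = -262537412640768000) {p : ℕ} (hp : p.Prime) (h2 : p ≠ 2)
    (hΔ : ¬ (p : ℤ) ∣ WeierstrassCurve.minimalDiscriminantInt W) (hpd : ¬ (p : ℤ) ∣ -163)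
    (hsq : IsSquare ((-163 : ℤ) : ZMod p)) :
    ∃ π : ℂ, π ∈ cmRing (-163) ∧ π * conj π = p ∧ (W.frobeniusTrace p : ℂ) = π + conj π := by
  haveI := isElliptic_cert163
  haveI := isElliptic_cert163'
  obtain ⟨lam, hlam⟩ := exists_isogeny_degree_eq_of_cert
    (E := (⟨0, 0, 0, -34790720, 78984748304⟩ : WeierstrassCurve ℚ))
    (E' := (⟨0, 0, 0, -924354639680, -342062961763303088⟩ : WeierstrassCurve ℚ)) cert163
    checkFast_cert163 cert163Cop checkCoprime_cert163 (by rw [cert163Cop_ℓ]; norm_num)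
    (by rw [cert163_a₁, cert163_a₂, cert163_a₃, cert163_a₄, cert163_a₆]; norm_num)
    (by rw [cert163_a₁', cert163_a₂', cert163_a₃', cert163_a₄', cert163_a₆']; norm_num)
  rw [show cert163.U.length - 1 = 163 by decide +kernel] at hlam
  have h := exists_pi_of_isogeny_prime lam (by norm_num) hlam rfl rfl (by ext <;> norm_num)
    (by decide) W (by rw [hj, j_cert163 rfl]) (by rw [j_cert163 rfl]; norm_num)
    (by rw [j_cert163 rfl]; norm_num) hp h2 hΔ (by exact_mod_cast hpd) (by exact_mod_cast hsq)
  exact_mod_cast h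

end Cases

end Literature.NumberTheory.EllipticCurves.DeuringLadic

/-! ### Discharge of the named fact -/

namespace Literature.NumberTheory.EllipticCurves

open DeuringLadic

/-- **Discharge of `Deuring1941_frobeniusTrace_eq_add_conj` (Deuring 1941; Cox, *Primes of the
form x² + ny²*, Thm. 14.16): for a globally minimal `W/ℚ` with `j(W) ∈ maximalCMJInvariants` and
an odd prime `p ∤ Δ_W d_K` with `d_K` a square modulo `p`, `a_p(W) = π + π̄` with
`π ∈ 𝓞_K = ℤ[ω_{d_K}]`, `ππ̄ = p`.** Nine-way case split on `j`: the cases `j = 0, 1728` are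
Gauss's (the tree's `Deuring1941_frobeniusTrace_eq_add_conj_of_j_eq_zero`,
`Deuring1941_frobeniusTrace_eq_add_conj_of_j_eq`, by Jacobi sums), and the seven others follow from
the `ℓ`-adic engine `DeuringLadic.exists_natAbs_eq_and_mul_eq_sq` applied to the `ℚ`-isogeny
`E → E^{(d_K)}` (the kernel-certified isogenies of degree `7, 11, 19, 43, 67, 163` and Silverman's
`2`-isogeny for `j = 8000`): the endomorphism `μ = τ⁻¹ ∘ λ` of `E(ℚ̄)` satisfies
`μ² = [m]`, `|m| = deg λ` (`End_ℚ(E) = ℤ`), it commutes with an arithmetic Frobenius `σ_p` (which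
fixes `√d_K` as `p` splits) and anti-commutes with complex conjugation, so on `T_ℓ E` one reads
`4m = v²(a_p² - 4p)`, i.e. `m(a_p² - 4p)` is a square in every `ℚ_ℓ`, `ℓ ≠ p`, hence in `ℚ`;
Hasse's bound gives the sign `m = d_K` (resp. `-2`), so `a_p² - 4p = d_K w²` and
`π = (a_p + w√d_K)/2`. This replaces Deuring's lifting theorem (Lang, *Elliptic Functions*,
Ch. 13 Thm. 12) in Cox's proof by the `ℓ`-adic representation and the reduction isomorphism
`T_ℓ(E) ≅ T_ℓ(Ẽ)` (Silverman, *AEC*, VII.4.1, C.21 Remark 21.3), all proved in the tree.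
[cite: Cox2013, Thm. 14.16 (§14.C, PDF pp. 322–323)] [cite: Deuring1941]
[cite: SilvermanAEC2009, C.21 Remark 21.3 with Prop. VII.4.1 and III.§7] -/
theorem Deuring1941_frobeniusTrace_eq_add_conj_holds : Deuring1941_frobeniusTrace_eq_add_conj := by
  intro W _ _ hj p hp h2 hΔ hd hsq
  simp only [maximalCMJInvariants, Finset.mem_insert, Finset.mem_singleton] at hj
  rcases hj with hj | hj | hj | hj | hj | hj | hj | hj | hj
  · exact Deuring1941_frobeniusTrace_eq_add_conj_of_j_eq_zero W hj p hp h2 hΔ hd hsq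
  · exact Deuring1941_frobeniusTrace_eq_add_conj_of_j_eq W hj p hp h2 hΔ hd hsq
  · have hd' : cmDiscr W.j = -7 := by rw [hj]; norm_num [cmDiscr]
    rw [hd'] at hd hsq ⊢
    exact exists_pi_of_j_eq_neg3375 W hj hp h2 hΔ hd hsq
  · have hd' : cmDiscr W.j = -8 := by rw [hj]; norm_num [cmDiscr]
    rw [hd'] at hd hsq ⊢
    exact exists_pi_of_j_eq_8000 W hj hp h2 hΔ hsq
  · have hd' : cmDiscr W.j = -11 := by rw [hj]; norm_num [cmDiscr]
    rw [hd'] at hd hsq ⊢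
    exact exists_pi_of_j_eq_neg32768 W hj hp h2 hΔ hd hsq
  · have hd' : cmDiscr W.j = -19 := by rw [hj]; norm_num [cmDiscr]
    rw [hd'] at hd hsq ⊢
    exact exists_pi_of_j_eq_neg884736 W hj hp h2 hΔ hd hsq
  · have hd' : cmDiscr W.j = -43 := by rw [hj]; norm_num [cmDiscr]
    rw [hd'] at hd hsq ⊢
    exact exists_pi_of_j_eq_neg884736000 W hj hp h2 hΔ hd hsq
  · have hd' : cmDiscr W.j = -67 := by rw [hj]; norm_num [cmDiscr]
    rw [hd'] at hd hsq ⊢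
    exact exists_pi_of_j_eq_neg147197952000 W hj hp h2 hΔ hd hsq
  · have hd' : cmDiscr W.j = -163 := by rw [hj]; norm_num [cmDiscr]
    rw [hd'] at hd hsq ⊢
    exact exists_pi_of_j_eq_neg262537412640768000 W hj hp h2 hΔ hd hsq

end Literature.NumberTheory.EllipticCurves
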